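import Literature.NumberTheory.LFunctions.CramerMeanSquareRH
import Literature.NumberTheory.LFunctions.ZeroDensityInghamHuxley
import Literature.NumberTheory.LFunctions.ZetaZerosProofs
import Literature.NumberTheory.LFunctions.AFEHarmonicSums
import Literature.NumberTheory.LFunctions.RichertBoundsFromExpSum
import Literature.NumberTheory.LFunctions.VinogradovZetaSumEstimate
import Literature.NumberTheory.LFunctions.ZeroDensityNearOne
import Literature.NumberTheory.LFunctions.GuthMaynardPrimeCorollaries
import HarnessLib

/-!
# Guth–Maynard §13.2: the mean square of `ψ` in short intervals (proof of Corollary 1.4, first half)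

NOT RH-BEARING — a zero-density theorem counts zeros off the critical line, it never empties the
strip (`Literature.Barriers.RiemannHypothesis.LindelofBacklund`); nothing in this file bears on the
truth of RH. bears_on: LADDER-RH §4 HELD row `DensityLadder` (corpus C4, RH-FREE literature).

Topic `Literature/NumberTheory/LFunctions`. Everything in this file is PROVED (no definition, no
named fact). Source: L. Guth, J. Maynard, *New large value estimates for Dirichlet polynomials*,
Ann. of Math. (2) 203 (2026) 623–675 = arXiv:2405.20552, §13, proof of Corollary 1.4
(arXiv chunk p0029:L30–L62):

> "Applying the explicit formula as above with `T = δ⁻¹exp(4(log X)^{1/4})`, we see that it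
> suffices to show that `∫_X^{3X} |Σ_{|ρ|<T} x^ρ((1+δ)^ρ − 1)/ρ|² dx ≪ δ²X³exp(−3(log X)^{1/4})`.
> Expanding the sum, and performing the integral over `x`, we obtain
> `… ≪ δ² Σ_{|ρ₁|,|ρ₂|<T} X^{Re ρ₁+Re ρ₂+1}/|ρ₁ + conj ρ₂ + 1|`. Since
> `X^{Re ρ₁+Re ρ₂+1} ≤ X^{2Re ρ₁+1} + X^{2Re ρ₂+1}`, and … `Σ_{|ρ₂|<T} |1+z+conj ρ₂|⁻¹ ≪ (log T)²` …
> `∫ … ≪ (log X)³ δ² sup_σ X^{2σ+1} N(σ,T)`. As above, applying (eq:ZeroDensity) and the zero-free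
> region, `sup_σ X^{2σ+1}N(σ,T) ≪ X³ sup_{σ ≤ 1−c(log T)^{−5/7}} (T^{30/13+o(1)}/X²)^{1−σ}
> ≪_ε X³exp(−10(log X)^{1/4})`."

The file follows the printed argument step by step, unconditionally and with the density input
kept as an explicit hypothesis:

* §1 `exists_norm_psi_sub_add_zeroSum_le` — the truncated explicit formula (Montgomery–Vaughan
  Thm. 12.5, tree `truncatedExplicitFormula_psi_holds`) with the crude remainder
  `O(log x + (x/T) log²(xT))` (`min(1, x/(T⟨x⟩)) ≤ 1`; `ψ₀` versus `ψ` by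
  `CramerMeanSquare.abs_psi_sub_chebyshevPsi₀_le`);
* §2–§3 `norm_shiftCoeff_le` (`|((1+δ)^ρ − 1)/ρ| ≤ δ`), `zetaZeroSumTrunc_mul_sub`,
  `abs_psi_shift_sub_le` — the differenced explicit formula on `[X, 3X]`;
* §4 `integral_normSq_sum_le` — "expanding the sum and performing the integral over `x`":
  `∫_X^{3X} ‖Σ a_ρ x^ρ‖² ≤ Σ_{ρ₁,ρ₂} ‖a₁‖‖a₂‖·28X^{β₁+β₂+1}/‖1+ρ₁+conj ρ₂‖` (`integral_cpow`);
* §5 `sum_sum_le_of_symm` — the AM–GM symmetrisation `X^{β₁+β₂} ≤ (X^{2β₁}+X^{2β₂})/2`;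
* §6 `exists_kernelSum_le` — `Σ_{|γ₂|≤T} m(ρ₂)/‖1+ρ₁+conj ρ₂‖ ≪ log²T` from the local counts
  `N(t+½) − N(t−½) ≪ log(|t|+2)` (tree `ZeroOrdinateSums.exists_sum_le_of_abs_im_sub_le`,
  Montgomery–Vaughan Thm. 10.13) summed over harmonic shells;
* §7 `sum_order_mul_rpow_le_bins` ("`1/log x`-separated values of `σ`"),
  `sum_order_filter_le_two_mul_count` (the two-sided count is `2N(σ,T)`, by
  `riemannZetaZeroOrder_conj_holds`), `exists_sum_order_le` (`Σ_{|γ|≤T} m(ρ) ≪ T log T`);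
* §8 `exists_meanSquare_le_zeroSum` — the density-free bound
  `∫_X^{3X}(ψ(x+δx)−ψ(x)−δx)² ≤ C(δ²X log²X Σ_{|γ|≤T} m(ρ)X^{2β} + X log²X + X³log⁴X/T²)`;
* §9 `eventually_re_le_of_zeroFree` — from a Vinogradov–Korobov region (in the form proved in the
  tree: `zeta_zeroFree_of_expSumBound` with `VKZeta.expSumBound_ivic`, standard axioms only), all
  zeros with `|γ| ≤ X` have `β ≤ 1 − K(log X)^{−3/4}` for `X ≥ X₁(K)`;
* §10–§12 growth lemmas, the three ranges of `σ` (`binTerm_le`), and the assembly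
  `psiMeanSquareShort_of_combined`: from the combined density bound
  `N(σ,T) ≤ C T^{(30/13+η)(1−σ)}(log T)^B` (hypothesis; the tree's
  `zeroDensity_thirty_thirteenths_holds` supplies it away from `σ = 1`, a near-one density
  estimate of Montgomery/Jutila type near `σ = 1` — GM's "[J] or [M3]") and the zero-free region,
  for every `ε > 0` and every `A`:
  `∫_X^{3X}(ψ(x+δx)−ψ(x)−δx)² ≤ C δ²X³exp(−A(log X)^{1/4})`, `X ≥ X₀`,
  `X^{−13/15+ε} ≤ δ ≤ X^{−1/100}` (GM print `A = 3`; here `T = δ⁻¹exp((A+1)(log X)^{1/4})`).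

`psiMeanSquareShort_of_combinedDensity` discharges the zero-free hypothesis with the tree's
(standard-axiom) Ivić-chain VK region, leaving only the combined density bound; and
§13 closes the cell's interface statement
`Literature.NumberTheory.LFunctions.GuthMaynard2026_psiMeanSquareShort`
(`GuthMaynardPrimeCorollaries.lean`) from `NearOneZeroDensity` via
`zetaZeroCountRe_le_combined` (`ZeroDensityNearOne.lean`):
`GuthMaynard2026_psiMeanSquareShort_of_nearOne`, and from the named fact `Ivic1985_theorem11_3`
(Ivić 1985, Thm. 11.3): `GuthMaynard2026_psiMeanSquareShort_of_Ivic1985_theorem11_3`.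

Design: the kernel `1/‖1+ρ₁+conj ρ₂‖` is used exactly as printed (no smoothing), so only the
harmonic-shell count is needed; all "for `X` large" steps are `∀ᶠ X in atTop` facts in the scale
`exp(c(log X)^{1/4})`. No Guth–Maynard large-values input is used directly here — this is the
classical explicit-formula half of Cor. 1.4; the exponent `30/13` (tree:
`zeroDensity_thirty_thirteenths_holds`, inside `zetaZeroCountRe_le_combined`) enters only through
the density hypothesis.

## References

* L. Guth, J. Maynard, *New large value estimates for Dirichlet polynomials*, Ann. of Math. (2) 203
  (2026), no. 2, 623–675; arXiv:2405.20552, §13 (proof of Corollaries 1.3–1.4). [key `GuthMaynard2026`]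
* H. L. Montgomery, R. C. Vaughan, *Multiplicative Number Theory I*, CUP 2007, Thm. 10.13, Thm. 12.5,
  Thm. 13.5. [key `MontgomeryVaughan2007`]
* E. C. Titchmarsh, *The Theory of the Riemann Zeta-Function*, 2nd ed. (1986), §9.1, Thm. 3.10.
* A. Ivić, *The Riemann Zeta-Function* (1985), Thm. 6.2 (Vinogradov's estimate), Thm. 11.3 (the
  near-one density, the tree's named fact `Ivic1985_theorem11_3`).
-/

noncomputable section

open MeasureTheory Set Finset Complex Real intervalIntegral
open scoped ComplexConjugate Chebyshev

namespace Literature.NumberTheory.LFunctions.GuthMaynardPsiMeanSquare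

/-! ### §1 The explicit formula on `[2, ∞)`: `ψ(x) = x − Σ_{|γ|≤T} m(ρ)x^ρ/ρ + O(log x + (x/T) log²(xT))` -/

/-- **Pointwise explicit formula with crude remainder** (Montgomery–Vaughan Thm. 12.5, tree
`truncatedExplicitFormula_psi_holds`, with `min(1, x/(T⟨x⟩)) ≤ 1` and `|ψ − ψ₀| ≤ (log x)/2`):
there is `M ≥ 0` with `‖ψ(x) − x + Σ_{|γ| ≤ T} m(ρ) x^ρ/ρ‖ ≤ M (log x + (x/T) log²(xT))` for all
`x ≥ 2`, `T ≥ 2`. [cite: MontgomeryVaughan2007, Thm. 12.5] -/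
theorem exists_norm_psi_sub_add_zeroSum_le : ∃ M : ℝ, 0 ≤ M ∧ ∀ x : ℝ, 2 ≤ x → ∀ T : ℝ, 2 ≤ T →
    ‖((ψ x - x : ℝ) : ℂ) + zetaZeroSumTrunc x T‖ ≤
      M * (Real.log x + x / T * Real.log (x * T) ^ 2) := by
  obtain ⟨C, hC⟩ := truncatedExplicitFormula_psi_holds 2 (by norm_num)
  set C' := max C 0 with hC'
  refine ⟨C' + 6, by positivity, fun x hx T hT ↦ ?_⟩
  have hx0 : 0 < x := by linarith
  have hx1 : 1 ≤ x := by linarith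
  have hT0 : 0 < T := by linarith
  have hlog2 : (0.69 : ℝ) < Real.log 2 := by
    have := Real.log_two_gt_d9; linarith
  have hlogx : Real.log 2 ≤ Real.log x := Real.log_le_log (by norm_num) hx
  have hlogx0 : 0 ≤ Real.log x := by linarith
  have hB0 : 0 ≤ x / T * Real.log (x * T) ^ 2 := by positivity
  -- the explicit formula
  have hEF := hC x hx T hT
  set S := zetaZeroSumTrunc x T with hS
  have hRle : C * (Real.log x * min 1 (x / (T * primePowDist x)) + x / T * Real.log (x * T) ^ 2)
      ≤ C' * (Real.log x + x / T * Real.log (x * T) ^ 2) := by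
    have hmin0 : 0 ≤ min 1 (x / (T * primePowDist x)) :=
      le_min zero_le_one (div_nonneg hx0.le (mul_nonneg hT0.le (primePowDist_nonneg x)))
    have hA0 : 0 ≤ Real.log x * min 1 (x / (T * primePowDist x)) + x / T * Real.log (x * T) ^ 2 := by
      positivity
    have h1 : Real.log x * min 1 (x / (T * primePowDist x)) ≤ Real.log x := by
      calc Real.log x * min 1 (x / (T * primePowDist x)) ≤ Real.log x * 1 :=
            mul_le_mul_of_nonneg_left (min_le_left _ _) hlogx0
        _ = Real.log x := mul_one _
    calc C * (Real.log x * min 1 (x / (T * primePowDist x)) + x / T * Real.log (x * T) ^ 2)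
        ≤ C' * (Real.log x * min 1 (x / (T * primePowDist x)) + x / T * Real.log (x * T) ^ 2) :=
          mul_le_mul_of_nonneg_right (le_max_left _ _) hA0
      _ ≤ C' * (Real.log x + x / T * Real.log (x * T) ^ 2) := by gcongr
  -- the two constants of (12.3)
  have hc1 : |Real.log (2 * π)| ≤ 2 := by
    have hπ := Real.pi_lt_d2
    have hπ3 := Real.pi_gt_three
    have h1 : (1 : ℝ) ≤ 2 * π := by linarith
    rw [abs_of_nonneg (Real.log_nonneg h1), Real.log_le_iff_le_exp (by linarith)]
    have he : (2.7 : ℝ) < Real.exp 1 := by have := Real.exp_one_gt_d9; linarith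
    have he2 : Real.exp 2 = Real.exp 1 * Real.exp 1 := by rw [← Real.exp_add]; norm_num
    nlinarith [Real.exp_pos 1]
  have hc2 : |1 / 2 * Real.log (1 - 1 / x ^ 2)| ≤ 1 := by
    have hy0 : 3 / 4 ≤ 1 - 1 / x ^ 2 := by
      have : 1 / x ^ 2 ≤ 1 / 4 := by
        rw [div_le_div_iff₀ (by positivity) (by norm_num)]; nlinarith
      linarith
    have hy1 : 1 - 1 / x ^ 2 ≤ 1 := by
      have : 0 ≤ 1 / x ^ 2 := by positivity
      linarith
    have hlo := Real.one_sub_inv_le_log_of_pos (by linarith : (0 : ℝ) < 1 - 1 / x ^ 2)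
    have hhi := Real.log_nonpos (by linarith) hy1
    have : (1 - 1 / x ^ 2)⁻¹ ≤ 4 / 3 := by
      rw [inv_eq_one_div, div_le_div_iff₀ (by linarith) (by norm_num)]; linarith
    rw [abs_le]; constructor <;> linarith
  -- `‖ψ₀ x − x + S‖ ≤ C'(…) + 3`
  have hψ0 : ‖((chebyshevPsi₀ x - x : ℝ) : ℂ) + S‖ ≤
      C' * (Real.log x + x / T * Real.log (x * T) ^ 2) + 3 := by
    have hEF' : ‖(chebyshevPsi₀ x : ℂ) - ((x : ℂ) - S - (Real.log (2 * π) : ℂ)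
        - ((1 / 2 * Real.log (1 - 1 / x ^ 2) : ℝ) : ℂ))‖ ≤
        C' * (Real.log x + x / T * Real.log (x * T) ^ 2) := by
      refine le_trans ?_ (hEF.trans hRle)
      apply le_of_eq; congr 2; push_cast; ring
    set A := (chebyshevPsi₀ x : ℂ) - ((x : ℂ) - S - (Real.log (2 * π) : ℂ)
        - ((1 / 2 * Real.log (1 - 1 / x ^ 2) : ℝ) : ℂ)) with hA
    set B := (Real.log (2 * π) : ℂ) with hB
    set D := ((1 / 2 * Real.log (1 - 1 / x ^ 2) : ℝ) : ℂ) with hD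
    have e : ((chebyshevPsi₀ x - x : ℝ) : ℂ) + S = A - B - D := by
      rw [hA, hB, hD]; push_cast; ring
    have hBn : ‖B‖ ≤ 2 := by rw [hB, Complex.norm_real, Real.norm_eq_abs]; exact hc1
    have hDn : ‖D‖ ≤ 1 := by rw [hD, Complex.norm_real, Real.norm_eq_abs]; exact hc2
    rw [e]
    calc ‖A - B - D‖ ≤ ‖A - B‖ + ‖D‖ := norm_sub_le _ _
      _ ≤ ‖A‖ + ‖B‖ + ‖D‖ := by gcongr; exact norm_sub_le _ _
      _ ≤ C' * (Real.log x + x / T * Real.log (x * T) ^ 2) + 2 + 1 := by gcongr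
      _ = _ := by ring
  have hψψ0 := CramerMeanSquare.abs_psi_sub_chebyshevPsi₀_le hx1
  have e2 : ((ψ x - x : ℝ) : ℂ) + S = ((ψ x - chebyshevPsi₀ x : ℝ) : ℂ) +
      (((chebyshevPsi₀ x - x : ℝ) : ℂ) + S) := by push_cast; ring
  rw [e2]
  calc ‖((ψ x - chebyshevPsi₀ x : ℝ) : ℂ) + (((chebyshevPsi₀ x - x : ℝ) : ℂ) + S)‖
      ≤ ‖((ψ x - chebyshevPsi₀ x : ℝ) : ℂ)‖ + ‖((chebyshevPsi₀ x - x : ℝ) : ℂ) + S‖ := norm_add_le _ _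
    _ ≤ Real.log x / 2 + (C' * (Real.log x + x / T * Real.log (x * T) ^ 2) + 3) := by
        rw [Complex.norm_real, Real.norm_eq_abs]; exact add_le_add hψψ0 hψ0
    _ ≤ (C' + 6) * (Real.log x + x / T * Real.log (x * T) ^ 2) := by
        have h3 : (3 : ℝ) ≤ 5 * Real.log x := by linarith
        nlinarith [le_max_right C 0]

/-! ### §2 The coefficients `c_δ(ρ) = ((1+δ)^ρ − 1)/ρ` -/

/-- `‖c_δ(ρ)‖ ≤ δ` for `δ ≥ 0` and `0 < Re ρ ≤ 1` (GM: "the term in parentheses is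
`∫_x^{x+y} t^{ρ−1} dt ≪ y x^{Re ρ − 1}`", here at `x = 1`). [cite: GuthMaynard2026, §13.2, proof of Corollary 1.3, arXiv p0029:L3–L28] -/
theorem norm_shiftCoeff_le {δ : ℝ} (hδ : 0 ≤ δ) {ρ : ℂ} (h0 : 0 < ρ.re) (h1 : ρ.re ≤ 1) :
    ‖(((((1 + δ : ℝ)) : ℂ) ^ ρ - 1) / ρ)‖ ≤ δ := by
  have hρ0 : ρ ≠ 0 := fun h ↦ by rw [h] at h0; simp at h0
  -- `∫_1^{1+δ} t^{ρ-1} dt = ((1+δ)^ρ - 1)/ρ`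
  have hint : ∫ t in (1 : ℝ)..(1 + δ), (t : ℂ) ^ (ρ - 1) = (((((1 + δ : ℝ)) : ℂ) ^ ρ - 1) / ρ) := by
    rw [integral_cpow (Or.inl (by simp; linarith))]
    simp only [sub_add_cancel]
    push_cast
    rw [Complex.one_cpow]
  rw [← hint]
  have hb : ∀ t ∈ Set.uIoc (1 : ℝ) (1 + δ), ‖(t : ℂ) ^ (ρ - 1)‖ ≤ 1 := by
    intro t ht
    rw [Set.uIoc_of_le (by linarith), Set.mem_Ioc] at ht
    have ht0 : 0 < t := by linarith [ht.1]
    rw [Complex.norm_cpow_eq_rpow_re_of_pos ht0, Complex.sub_re, Complex.one_re]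
    exact Real.rpow_le_one_of_one_le_of_nonpos ht.1.le (by linarith)
  have := intervalIntegral.norm_integral_le_of_norm_le_const hb
  simpa [abs_of_nonneg hδ] using this

/-! ### §3 The differenced zero sum `Z(x) = Σ m(ρ) c_δ(ρ) x^ρ` -/

/-- Members of `W_T` are non-trivial zeros with `|Im ρ| ≤ T`, `0 < Re ρ < 1`. [folklore] -/
private theorem mem_WT {T : ℝ} {ρ : ℂ} (h : ρ ∈ (weilZeroIndex_finite T).toFinset) :
    ρ ∈ ZetaZeros.riemannZetaNontrivialZeros ∧ |ρ.im| ≤ T ∧ 0 < ρ.re ∧ ρ.re < 1 := by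
  rw [Set.Finite.mem_toFinset, weilZeroIndex_eq_inter] at h
  exact ⟨h.1, h.2, ZetaZeros.riemannZetaNontrivialZeros.re_pos h.1,
    ZetaZeros.riemannZetaNontrivialZeros.re_lt_one h.1⟩

/-- `m(ρ) ≥ 0` on `W_T` (as a real number). [folklore] -/
private theorem order_nonneg_of_mem_WT {T : ℝ} {ρ : ℂ} (h : ρ ∈ (weilZeroIndex_finite T).toFinset) : (0 : ℝ) ≤ (riemannZetaZeroOrder ρ : ℝ) :=
  riemannZetaZeroOrder_nonneg_of_zero (ZetaZeros.riemannZetaNontrivialZeros.zeta_eq_zero (mem_WT h).1)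

/-- **`Σ_{|γ|≤T} m(ρ)((x(1+δ))^ρ − x^ρ)/ρ = Σ m(ρ) c_δ(ρ) x^ρ`** for `x > 0`, `δ ≥ 0`. [folklore] -/
private theorem zetaZeroSumTrunc_mul_sub {x δ : ℝ} (hx : 0 < x) (hδ : 0 ≤ δ) (T : ℝ) :
    zetaZeroSumTrunc (x * (1 + δ)) T - zetaZeroSumTrunc x T =
      ∑ ρ ∈ (weilZeroIndex_finite T).toFinset, (riemannZetaZeroOrder ρ : ℂ) * (((((1 + δ : ℝ)) : ℂ) ^ ρ - 1) / ρ) * (x : ℂ) ^ ρ := by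
  unfold zetaZeroSumTrunc
  rw [← Finset.sum_sub_distrib]
  refine Finset.sum_congr rfl fun ρ _ ↦ ?_
  have hδ1 : (0 : ℝ) ≤ 1 + δ := by linarith
  have e : (((x * (1 + δ) : ℝ)) : ℂ) ^ ρ = (x : ℂ) ^ ρ * (((1 + δ : ℝ)) : ℂ) ^ ρ := by
    rw [← Complex.mul_cpow_ofReal_nonneg hx.le hδ1 ρ]
    push_cast; ring_nf
  rw [e]
  ring

/-- **The differenced explicit formula on `[X, 3X]`**: with `M` from
`exists_norm_psi_sub_add_zeroSum_le`, for `X ≥ 2`, `0 ≤ δ ≤ 1`, `2 ≤ T`, `x ∈ [X, 3X]`,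
`|ψ(x + δx) − ψ(x) − δx| ≤ ‖Z(x)‖ + 2M(log(6X) + (6X/T) log²(6XT))`. [cite: GuthMaynard2026, §13.2, proof of Corollary 1.4, arXiv p0029:L30–L62] -/
theorem abs_psi_shift_sub_le {M : ℝ} (hM0 : 0 ≤ M)
    (hM : ∀ x : ℝ, 2 ≤ x → ∀ T : ℝ, 2 ≤ T →
      ‖((ψ x - x : ℝ) : ℂ) + zetaZeroSumTrunc x T‖ ≤ M * (Real.log x + x / T * Real.log (x * T) ^ 2))
    {X δ T : ℝ} (hX : 2 ≤ X) (hδ0 : 0 ≤ δ) (hδ1 : δ ≤ 1) (hT : 2 ≤ T) {x : ℝ} (hx : x ∈ Icc X (3 * X)) :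
    |ψ (x + δ * x) - ψ x - δ * x| ≤
      ‖∑ ρ ∈ (weilZeroIndex_finite T).toFinset, (riemannZetaZeroOrder ρ : ℂ) * (((((1 + δ : ℝ)) : ℂ) ^ ρ - 1) / ρ) * (x : ℂ) ^ ρ‖ +
        2 * (M * (Real.log (6 * X) + 6 * X / T * Real.log (6 * X * T) ^ 2)) := by
  rw [Set.mem_Icc] at hx
  have hx2 : 2 ≤ x := hX.trans hx.1
  have hx0 : 0 < x := by linarith
  have hT0 : 0 < T := by linarith
  set x' := x * (1 + δ) with hx'
  have hx'eq : x + δ * x = x' := by rw [hx']; ring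
  have hx'2 : 2 ≤ x' := by rw [hx']; nlinarith
  have hx'le : x' ≤ 6 * X := by rw [hx']; nlinarith
  have hxle : x ≤ 6 * X := by linarith
  -- monotonicity of the remainder shape in `x ≤ 6X`
  have hrem : ∀ y : ℝ, 2 ≤ y → y ≤ 6 * X →
      M * (Real.log y + y / T * Real.log (y * T) ^ 2) ≤
        M * (Real.log (6 * X) + 6 * X / T * Real.log (6 * X * T) ^ 2) := by
    intro y hy2 hy4
    have hy0 : 0 < y := by linarith
    have hlog0 : 0 ≤ Real.log (y * T) := Real.log_nonneg (by nlinarith)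
    refine mul_le_mul_of_nonneg_left ?_ hM0
    gcongr
  have h1 := (hM x hx2 T hT).trans (hrem x hx2 hxle)
  have h2 := (hM x' hx'2 T hT).trans (hrem x' hx'2 hx'le)
  have hZ := zetaZeroSumTrunc_mul_sub hx0 hδ0 T
  rw [← hx'] at hZ
  -- the real quantity as the real part of a complex combination
  have e : ((ψ (x + δ * x) - ψ x - δ * x : ℝ) : ℂ) =
      (((ψ x' - x' : ℝ) : ℂ) + zetaZeroSumTrunc x' T) - (((ψ x - x : ℝ) : ℂ) + zetaZeroSumTrunc x T)
        - (zetaZeroSumTrunc x' T - zetaZeroSumTrunc x T) := by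
    rw [hx'eq]; push_cast; rw [hx']; push_cast; ring
  have hn : |ψ (x + δ * x) - ψ x - δ * x| = ‖((ψ (x + δ * x) - ψ x - δ * x : ℝ) : ℂ)‖ := by
    rw [Complex.norm_real, Real.norm_eq_abs]
  rw [hn, e, hZ]
  calc ‖(((ψ x' - x' : ℝ) : ℂ) + zetaZeroSumTrunc x' T) - (((ψ x - x : ℝ) : ℂ) + zetaZeroSumTrunc x T)
        - ∑ ρ ∈ (weilZeroIndex_finite T).toFinset, (riemannZetaZeroOrder ρ : ℂ) * (((((1 + δ : ℝ)) : ℂ) ^ ρ - 1) / ρ) * (x : ℂ) ^ ρ‖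
      ≤ ‖(((ψ x' - x' : ℝ) : ℂ) + zetaZeroSumTrunc x' T) - (((ψ x - x : ℝ) : ℂ) + zetaZeroSumTrunc x T)‖
        + ‖∑ ρ ∈ (weilZeroIndex_finite T).toFinset, (riemannZetaZeroOrder ρ : ℂ) * (((((1 + δ : ℝ)) : ℂ) ^ ρ - 1) / ρ) * (x : ℂ) ^ ρ‖ := norm_sub_le _ _
    _ ≤ (‖((ψ x' - x' : ℝ) : ℂ) + zetaZeroSumTrunc x' T‖ + ‖((ψ x - x : ℝ) : ℂ) + zetaZeroSumTrunc x T‖)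
        + ‖∑ ρ ∈ (weilZeroIndex_finite T).toFinset, (riemannZetaZeroOrder ρ : ℂ) * (((((1 + δ : ℝ)) : ℂ) ^ ρ - 1) / ρ) * (x : ℂ) ^ ρ‖ := by
          gcongr; exact norm_sub_le _ _
    _ ≤ _ := by linarith

/-! ### §4 Mean square of a finite sum `Σ a_ρ x^ρ` over `[X, 2X]` -/

/-- For real `x > 0`: `conj (x^ρ) = x^{conj ρ}`. [folklore] -/
private theorem conj_ofReal_cpow {x : ℝ} (hx : 0 < x) (ρ : ℂ) : conj ((x : ℂ) ^ ρ) = (x : ℂ) ^ conj ρ := by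
  have harg : (x : ℂ).arg ≠ π := by
    rw [Complex.arg_ofReal_of_nonneg hx.le]; exact Real.pi_pos.ne
  rw [Complex.cpow_conj _ _ harg, Complex.conj_ofReal]

/-- **Expanding the square**: for `x > 0`,
`‖Σ_ρ a_ρ x^ρ‖² = Σ_{ρ₁,ρ₂} Re(a_{ρ₁} conj(a_{ρ₂}) x^{ρ₁ + conj ρ₂})`. [folklore] -/
private theorem normSq_sum_mul_cpow (F : Finset ℂ) (a : ℂ → ℂ) {x : ℝ} (hx : 0 < x) :
    ‖∑ ρ ∈ F, a ρ * (x : ℂ) ^ ρ‖ ^ 2 =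
      ∑ ρ₁ ∈ F, ∑ ρ₂ ∈ F, (a ρ₁ * conj (a ρ₂) * (x : ℂ) ^ (ρ₁ + conj ρ₂)).re := by
  set z := ∑ ρ ∈ F, a ρ * (x : ℂ) ^ ρ with hz
  have hx0 : (x : ℂ) ≠ 0 := Complex.ofReal_ne_zero.2 hx.ne'
  have h1 : ‖z‖ ^ 2 = (z * conj z).re := by
    rw [Complex.mul_conj, Complex.ofReal_re, Complex.normSq_eq_norm_sq]
  have h2 : conj z = ∑ ρ ∈ F, conj (a ρ) * (x : ℂ) ^ conj ρ := by
    rw [hz, map_sum]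
    refine Finset.sum_congr rfl fun ρ _ ↦ ?_
    rw [map_mul, conj_ofReal_cpow hx]
  rw [h1, h2, hz, Finset.sum_mul_sum, Complex.re_sum]
  refine Finset.sum_congr rfl fun ρ₁ _ ↦ ?_
  rw [Complex.re_sum]
  refine Finset.sum_congr rfl fun ρ₂ _ ↦ ?_
  rw [Complex.cpow_add _ _ hx0]
  ring_nf

/-- **`‖∫_X^{3X} x^s dx‖ ≤ 28 X^{Re s + 1}/‖s + 1‖`** for `X > 0`, `0 ≤ Re s ≤ 2`. [folklore] -/
private theorem norm_integral_cpow_le {X : ℝ} (hX : 0 < X) {s : ℂ} (hs0 : 0 ≤ s.re) (hs2 : s.re ≤ 2) :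
    ‖∫ x in X..(3 * X), (x : ℂ) ^ s‖ ≤ 28 * X ^ (s.re + 1) / ‖s + 1‖ := by
  have hs1 : s + 1 ≠ 0 := fun h ↦ by
    have := congrArg Complex.re h; simp at this; linarith
  have hn0 : 0 < ‖s + 1‖ := norm_pos_iff.2 hs1
  rw [integral_cpow (Or.inl (by linarith)), norm_div]
  refine div_le_div_of_nonneg_right ?_ hn0.le
  have h3X : (0 : ℝ) < 3 * X := by linarith
  have e1 : ‖(((3 * X : ℝ)) : ℂ) ^ (s + 1)‖ = (3 * X) ^ (s.re + 1) := by
    rw [Complex.norm_cpow_eq_rpow_re_of_pos h3X]; simp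
  have e2 : ‖((X : ℝ) : ℂ) ^ (s + 1)‖ = X ^ (s.re + 1) := by
    rw [Complex.norm_cpow_eq_rpow_re_of_pos hX]; simp
  have h3 : (3 * X) ^ (s.re + 1) ≤ 27 * X ^ (s.re + 1) := by
    rw [Real.mul_rpow (by norm_num) hX.le]
    refine mul_le_mul_of_nonneg_right ?_ (Real.rpow_nonneg hX.le _)
    calc (3 : ℝ) ^ (s.re + 1) ≤ 3 ^ (3 : ℝ) :=
          Real.rpow_le_rpow_of_exponent_le (by norm_num) (by linarith)
      _ = 27 := by norm_num
  have hX0 : 0 ≤ X ^ (s.re + 1) := Real.rpow_nonneg hX.le _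
  calc ‖(((3 * X : ℝ)) : ℂ) ^ (s + 1) - ((X : ℝ) : ℂ) ^ (s + 1)‖
      ≤ ‖(((3 * X : ℝ)) : ℂ) ^ (s + 1)‖ + ‖((X : ℝ) : ℂ) ^ (s + 1)‖ := norm_sub_le _ _
    _ = (3 * X) ^ (s.re + 1) + X ^ (s.re + 1) := by rw [e1, e2]
    _ ≤ 27 * X ^ (s.re + 1) + X ^ (s.re + 1) := by linarith
    _ = 28 * X ^ (s.re + 1) := by ring

/-- **Mean square of `Σ a_ρ x^ρ` on `[X, 3X]`** (expand and integrate; GM: "Expanding the sum, and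
performing the integral over `x`"): if `0 < Re ρ ≤ 1` on `F` then
`∫_X^{3X} ‖Σ_ρ a_ρ x^ρ‖² dx ≤ Σ_{ρ₁,ρ₂} ‖a_{ρ₁}‖‖a_{ρ₂}‖ · 28X^{Re ρ₁ + Re ρ₂ + 1}/‖1 + ρ₁ + conj ρ₂‖`.
[cite: GuthMaynard2026, §13.2, proof of Corollary 1.4, arXiv p0029:L30–L62] -/
theorem integral_normSq_sum_le (F : Finset ℂ) (a : ℂ → ℂ)
    (hF : ∀ ρ ∈ F, 0 < ρ.re ∧ ρ.re ≤ 1) {X : ℝ} (hX : 0 < X) :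
    ∫ x in X..(3 * X), ‖∑ ρ ∈ F, a ρ * (x : ℂ) ^ ρ‖ ^ 2 ≤
      ∑ ρ₁ ∈ F, ∑ ρ₂ ∈ F,
        ‖a ρ₁‖ * ‖a ρ₂‖ * (28 * X ^ (ρ₁.re + ρ₂.re + 1) / ‖1 + ρ₁ + conj ρ₂‖) := by
  have hX2 : X ≤ 3 * X := by linarith
  have hpos : ∀ x ∈ uIcc X (3 * X), 0 < x := fun x hx ↦ by
    rw [Set.uIcc_of_le hX2] at hx; exact hX.trans_le hx.1
  -- Step 1: pointwise expansion
  have hcongr : ∫ x in X..(3 * X), ‖∑ ρ ∈ F, a ρ * (x : ℂ) ^ ρ‖ ^ 2 =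
      ∫ x in X..(3 * X), ∑ ρ₁ ∈ F, ∑ ρ₂ ∈ F,
        (a ρ₁ * conj (a ρ₂) * (x : ℂ) ^ (ρ₁ + conj ρ₂)).re :=
    intervalIntegral.integral_congr fun x hx ↦ normSq_sum_mul_cpow F a (hpos x hx)
  rw [hcongr]
  -- continuity of the terms
  have hre : ∀ ρ₁ ∈ F, ∀ ρ₂ ∈ F, 0 < (ρ₁ + conj ρ₂).re := fun ρ₁ h₁ ρ₂ h₂ ↦ by
    simp only [Complex.add_re, Complex.conj_re]; linarith [(hF ρ₁ h₁).1, (hF ρ₂ h₂).1]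
  have hcont : ∀ ρ₁ ∈ F, ∀ ρ₂ ∈ F,
      Continuous fun x : ℝ ↦ a ρ₁ * conj (a ρ₂) * (x : ℂ) ^ (ρ₁ + conj ρ₂) :=
    fun ρ₁ h₁ ρ₂ h₂ ↦ continuous_const.mul (Complex.continuous_ofReal_cpow_const (hre ρ₁ h₁ ρ₂ h₂))
  have hint : ∀ ρ₁ ∈ F, ∀ ρ₂ ∈ F, IntervalIntegrable
      (fun x : ℝ ↦ (a ρ₁ * conj (a ρ₂) * (x : ℂ) ^ (ρ₁ + conj ρ₂)).re) volume X (3 * X) :=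
    fun ρ₁ h₁ ρ₂ h₂ ↦ (Complex.continuous_re.comp (hcont ρ₁ h₁ ρ₂ h₂)).intervalIntegrable _ _
  -- Step 2: swap sum and integral
  have hint1 : ∀ ρ₁ ∈ F, IntervalIntegrable (fun x : ℝ ↦ ∑ ρ₂ ∈ F,
      (a ρ₁ * conj (a ρ₂) * (x : ℂ) ^ (ρ₁ + conj ρ₂)).re) volume X (3 * X) := by
    intro ρ₁ h₁
    refine ContinuousOn.intervalIntegrable (Continuous.continuousOn ?_)
    refine continuous_finsetSum F fun ρ₂ h₂ ↦ ?_
    exact Complex.continuous_re.comp (hcont ρ₁ h₁ ρ₂ h₂)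
  rw [intervalIntegral.integral_finsetSum hint1]
  refine Finset.sum_le_sum fun ρ₁ h₁ ↦ ?_
  rw [intervalIntegral.integral_finsetSum fun ρ₂ h₂ ↦ hint ρ₁ h₁ ρ₂ h₂]
  refine Finset.sum_le_sum fun ρ₂ h₂ ↦ ?_
  -- Step 3: one term
  set s := ρ₁ + conj ρ₂ with hs
  set A := a ρ₁ * conj (a ρ₂) with hA
  have hIc : IntervalIntegrable (fun x : ℝ ↦ A * (x : ℂ) ^ s) volume X (3 * X) :=
    (hcont ρ₁ h₁ ρ₂ h₂).intervalIntegrable _ _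
  have hcomm : ∫ x in X..(3 * X), (A * (x : ℂ) ^ s).re = (∫ x in X..(3 * X), A * (x : ℂ) ^ s).re := by
    have := Complex.reCLM.intervalIntegral_comp_comm hIc
    simpa using this
  rw [hcomm, intervalIntegral.integral_const_mul]
  have hsre : s.re = ρ₁.re + ρ₂.re := by simp [hs]
  have hs0 : 0 ≤ s.re := by rw [hsre]; linarith [(hF ρ₁ h₁).1, (hF ρ₂ h₂).1]
  have hs2 : s.re ≤ 2 := by rw [hsre]; linarith [(hF ρ₁ h₁).2, (hF ρ₂ h₂).2]
  have hI := norm_integral_cpow_le hX hs0 hs2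
  have hAn : ‖A‖ = ‖a ρ₁‖ * ‖a ρ₂‖ := by rw [hA, norm_mul, Complex.norm_conj]
  calc (A * ∫ x in X..(3 * X), (x : ℂ) ^ s).re ≤ ‖A * ∫ x in X..(3 * X), (x : ℂ) ^ s‖ := Complex.re_le_norm _
    _ = ‖A‖ * ‖∫ x in X..(3 * X), (x : ℂ) ^ s‖ := norm_mul _ _
    _ ≤ ‖A‖ * (28 * X ^ (s.re + 1) / ‖s + 1‖) := mul_le_mul_of_nonneg_left hI (norm_nonneg _)
    _ = ‖a ρ₁‖ * ‖a ρ₂‖ * (28 * X ^ (ρ₁.re + ρ₂.re + 1) / ‖1 + ρ₁ + conj ρ₂‖) := by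
        rw [hAn, hsre, hs, show ρ₁ + conj ρ₂ + 1 = 1 + ρ₁ + conj ρ₂ by ring]

/-! ### §5 Symmetrisation: `X^{β₁+β₂} ≤ (X^{2β₁} + X^{2β₂})/2` -/

/-- **AM–GM symmetrisation of a double sum**: for non-negative weights `w`, a symmetric
non-negative kernel `K` and real `u`,
`Σ_{ρ₁,ρ₂} w₁w₂ u₁u₂ K(ρ₁,ρ₂) ≤ Σ_{ρ₁} w₁u₁² Σ_{ρ₂} w₂ K(ρ₁,ρ₂)` (GM: "Since
`X^{Re ρ₁+Re ρ₂+1} ≤ X^{2Re ρ₁+1} + X^{2Re ρ₂+1}`"). [cite: GuthMaynard2026, §13.2, proof of Corollary 1.4, arXiv p0029:L30–L62] -/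
theorem sum_sum_le_of_symm (F : Finset ℂ) (w u : ℂ → ℝ) (K : ℂ → ℂ → ℝ)
    (hw : ∀ ρ ∈ F, 0 ≤ w ρ) (hK : ∀ ρ₁ ∈ F, ∀ ρ₂ ∈ F, 0 ≤ K ρ₁ ρ₂)
    (hsymm : ∀ ρ₁ ∈ F, ∀ ρ₂ ∈ F, K ρ₁ ρ₂ = K ρ₂ ρ₁) :
    ∑ ρ₁ ∈ F, ∑ ρ₂ ∈ F, w ρ₁ * w ρ₂ * (u ρ₁ * u ρ₂) * K ρ₁ ρ₂ ≤
      ∑ ρ₁ ∈ F, w ρ₁ * u ρ₁ ^ 2 * ∑ ρ₂ ∈ F, w ρ₂ * K ρ₁ ρ₂ := by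
  have hterm : ∀ ρ₁ ∈ F, ∀ ρ₂ ∈ F,
      w ρ₁ * w ρ₂ * (u ρ₁ * u ρ₂) * K ρ₁ ρ₂ ≤
        (w ρ₁ * w ρ₂ * u ρ₁ ^ 2 * K ρ₁ ρ₂ + w ρ₁ * w ρ₂ * u ρ₂ ^ 2 * K ρ₁ ρ₂) / 2 := by
    intro ρ₁ h₁ ρ₂ h₂
    have hwK : 0 ≤ w ρ₁ * w ρ₂ * K ρ₁ ρ₂ := mul_nonneg (mul_nonneg (hw ρ₁ h₁) (hw ρ₂ h₂)) (hK ρ₁ h₁ ρ₂ h₂)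
    nlinarith [mul_nonneg hwK (sq_nonneg (u ρ₁ - u ρ₂))]
  have hswap : ∑ ρ₁ ∈ F, ∑ ρ₂ ∈ F, w ρ₁ * w ρ₂ * u ρ₂ ^ 2 * K ρ₁ ρ₂ =
      ∑ ρ₁ ∈ F, ∑ ρ₂ ∈ F, w ρ₁ * w ρ₂ * u ρ₁ ^ 2 * K ρ₁ ρ₂ := by
    rw [Finset.sum_comm]
    refine Finset.sum_congr rfl fun ρ₁ h₁ ↦ Finset.sum_congr rfl fun ρ₂ h₂ ↦ ?_
    rw [hsymm ρ₂ h₂ ρ₁ h₁]; ring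
  calc ∑ ρ₁ ∈ F, ∑ ρ₂ ∈ F, w ρ₁ * w ρ₂ * (u ρ₁ * u ρ₂) * K ρ₁ ρ₂
      ≤ ∑ ρ₁ ∈ F, ∑ ρ₂ ∈ F,
          (w ρ₁ * w ρ₂ * u ρ₁ ^ 2 * K ρ₁ ρ₂ + w ρ₁ * w ρ₂ * u ρ₂ ^ 2 * K ρ₁ ρ₂) / 2 :=
        Finset.sum_le_sum fun ρ₁ h₁ ↦ Finset.sum_le_sum fun ρ₂ h₂ ↦ hterm ρ₁ h₁ ρ₂ h₂
    _ = (∑ ρ₁ ∈ F, ∑ ρ₂ ∈ F, w ρ₁ * w ρ₂ * u ρ₁ ^ 2 * K ρ₁ ρ₂ +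
          ∑ ρ₁ ∈ F, ∑ ρ₂ ∈ F, w ρ₁ * w ρ₂ * u ρ₂ ^ 2 * K ρ₁ ρ₂) / 2 := by
        have hin : ∀ ρ₁ ∈ F, ∑ ρ₂ ∈ F,
            (w ρ₁ * w ρ₂ * u ρ₁ ^ 2 * K ρ₁ ρ₂ + w ρ₁ * w ρ₂ * u ρ₂ ^ 2 * K ρ₁ ρ₂) / 2 =
            (∑ ρ₂ ∈ F, w ρ₁ * w ρ₂ * u ρ₁ ^ 2 * K ρ₁ ρ₂ +
              ∑ ρ₂ ∈ F, w ρ₁ * w ρ₂ * u ρ₂ ^ 2 * K ρ₁ ρ₂) / 2 := by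
          intro ρ₁ _
          rw [← Finset.sum_add_distrib, Finset.sum_div]
        rw [Finset.sum_congr rfl hin, ← Finset.sum_div, Finset.sum_add_distrib]
    _ = ∑ ρ₁ ∈ F, ∑ ρ₂ ∈ F, w ρ₁ * w ρ₂ * u ρ₁ ^ 2 * K ρ₁ ρ₂ := by rw [hswap]; ring
    _ = ∑ ρ₁ ∈ F, w ρ₁ * u ρ₁ ^ 2 * ∑ ρ₂ ∈ F, w ρ₂ * K ρ₁ ρ₂ := by
        refine Finset.sum_congr rfl fun ρ₁ _ ↦ ?_
        rw [Finset.mul_sum]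
        refine Finset.sum_congr rfl fun ρ₂ _ ↦ ?_
        ring

/-! ### §6 The kernel sum `Σ_{|γ₂| ≤ T} m(ρ₂)/‖1 + ρ₁ + conj ρ₂‖ ≪ log² T` -/

/-- **Harmonic shell sum over integers**: if `|k − u| < N + 1` on `K ⊆ ℤ` then
`Σ_{k ∈ K} 1/(1 + |k − u|) ≤ 2(1 + log(N + 2))` (each shell `⌊|k − u|⌋ = j` holds at most two
integers). [folklore] -/
private theorem sum_inv_one_add_abs_sub_le (K : Finset ℤ) (u : ℝ) (N : ℕ)
    (hK : ∀ k ∈ K, |(k : ℝ) - u| < N + 1) :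
    ∑ k ∈ K, 1 / (1 + |(k : ℝ) - u|) ≤ 2 * (1 + Real.log (N + 2)) := by
  have hmaps : ∀ k ∈ K, ⌊|(k : ℝ) - u|⌋₊ ∈ Finset.range (N + 1) := by
    intro k hk
    rw [Finset.mem_range]
    have := hK k hk
    exact (Nat.floor_lt (abs_nonneg _)).2 (by exact_mod_cast this)
  rw [← Finset.sum_fiberwise_of_maps_to hmaps]
  have hfib : ∀ j ∈ Finset.range (N + 1),
      ∑ k ∈ K with ⌊|((k : ℤ) : ℝ) - u|⌋₊ = j, 1 / (1 + |((k : ℤ) : ℝ) - u|) ≤ 2 * (1 / (1 + (j : ℝ))) := by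
    intro j _
    calc ∑ k ∈ K with ⌊|((k : ℤ) : ℝ) - u|⌋₊ = j, 1 / (1 + |((k : ℤ) : ℝ) - u|)
        ≤ ∑ k ∈ K with ⌊|((k : ℤ) : ℝ) - u|⌋₊ = j, 1 / (1 + (j : ℝ)) := by
          refine Finset.sum_le_sum fun k hk ↦ ?_
          rw [Finset.mem_filter] at hk
          have hfl : (j : ℝ) ≤ |(k : ℝ) - u| := by rw [← hk.2]; exact Nat.floor_le (abs_nonneg _)
          exact one_div_le_one_div_of_le (by positivity) (by linarith)
      _ = ((K.filter fun k : ℤ ↦ ⌊|(k : ℝ) - u|⌋₊ = j).card : ℝ) * (1 / (1 + (j : ℝ))) := by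
          rw [Finset.sum_const, nsmul_eq_mul]
      _ ≤ 2 * (1 / (1 + (j : ℝ))) := by
          refine mul_le_mul_of_nonneg_right ?_ (by positivity)
          exact_mod_cast ZeroOrdinateSums.card_filter_floor_eq_le_two K u j
  have hH : ∑ j ∈ Finset.range (N + 1), 1 / (1 + (j : ℝ)) ≤ 1 + Real.log ((N : ℝ) + 2) := by
    calc ∑ j ∈ Finset.range (N + 1), 1 / (1 + (j : ℝ)) ≤ 1 + Real.log (((N + 1 : ℕ) : ℝ) + 1) :=
          AFE.sum_range_inv_succ_le_log (N + 1)
      _ = 1 + Real.log ((N : ℝ) + 2) := by push_cast; ring_nf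
  calc ∑ j ∈ Finset.range (N + 1), ∑ k ∈ K with ⌊|((k : ℤ) : ℝ) - u|⌋₊ = j, 1 / (1 + |((k : ℤ) : ℝ) - u|)
      ≤ ∑ j ∈ Finset.range (N + 1), 2 * (1 / (1 + (j : ℝ))) := Finset.sum_le_sum hfib
    _ = 2 * ∑ j ∈ Finset.range (N + 1), 1 / (1 + (j : ℝ)) := by rw [Finset.mul_sum]
    _ ≤ 2 * (1 + Real.log (N + 2)) := mul_le_mul_of_nonneg_left hH (by norm_num)

/-- Elementary: for `T ≥ 2`, `log(2T + 3) ≤ 3 log T` and `1 ≤ 2 log T`. [folklore] -/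
private theorem log_aux {T : ℝ} (hT : 2 ≤ T) :
    Real.log (2 * T + 3) ≤ 3 * Real.log T ∧ 1 ≤ 2 * Real.log T := by
  have hT0 : 0 < T := by linarith
  constructor
  · have e : Real.log (T ^ 3) = 3 * Real.log T := by rw [Real.log_pow]; norm_num
    rw [← e]
    refine Real.log_le_log (by linarith) ?_
    have h4 : 4 ≤ T ^ 2 := by nlinarith
    nlinarith
  · have h := Real.log_le_log (by norm_num) hT
    linarith [Real.log_two_gt_d9]

/-- **Zero sums against `1/(1 + |γ − t|)`** (GM: "since there are `O(log T)` zeros in a horizontal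
strip of height 1, `Σ_{|ρ₂|<T} |1 + z + conj ρ₂|⁻¹ ≪ (log T)²`"): there is `C > 0` with
`Σ_{|γ| ≤ T} m(ρ)/(1 + |γ − t|) ≤ C log² T` for `T ≥ 2`, `|t| ≤ T`. [cite: GuthMaynard2026, §13.2, proof of Corollary 1.4, arXiv p0029:L30–L62] -/
theorem exists_sum_order_div_one_add_abs_le : ∃ C : ℝ, 0 < C ∧ ∀ T : ℝ, 2 ≤ T → ∀ t : ℝ, |t| ≤ T →
    ∑ ρ ∈ (weilZeroIndex_finite T).toFinset, (riemannZetaZeroOrder ρ : ℝ) * (1 / (1 + |ρ.im - t|)) ≤ C * Real.log T ^ 2 := by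
  obtain ⟨Cw, hCw0, hCw⟩ := ZeroOrdinateSums.exists_sum_le_of_abs_im_sub_le
  refine ⟨60 * Cw, by positivity, fun T hT t ht ↦ ?_⟩
  have hT0 : 0 < T := by linarith
  obtain ⟨hlogA, hlogB⟩ := log_aux hT
  have hlogT : 0 < Real.log T := by linarith
  set wt : ℤ → ℝ := fun k ↦ 2 / (1 + |(k : ℝ) - t|) with hwt
  have hwt0 : ∀ k, 0 ≤ wt k := fun k ↦ by positivity
  have hF : ∀ ρ ∈ (weilZeroIndex_finite T).toFinset, ρ ∈ ZetaZeros.riemannZetaNontrivialZeros := fun ρ h ↦ (mem_WT h).1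
  have hg : ∀ ρ ∈ (weilZeroIndex_finite T).toFinset, 1 / (1 + |ρ.im - t|) ≤ wt (round ρ.im) := by
    intro ρ _
    have hr : |ρ.im - round ρ.im| ≤ 1 / 2 := abs_sub_round ρ.im
    have h1 : |((round ρ.im : ℤ) : ℝ) - t| ≤ 1 / 2 + |ρ.im - t| := by
      have := abs_sub_le (((round ρ.im : ℤ) : ℝ)) ρ.im t
      rw [abs_sub_comm] at hr
      linarith
    simp only [hwt]
    rw [div_le_div_iff₀ (by positivity) (by positivity)]
    linarith [abs_nonneg (ρ.im - t)]
  have h := ZeroOrdinateSums.sum_mul_le_of_ordinate_majorant hCw hwt0 ((weilZeroIndex_finite T).toFinset) hF hg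
  refine h.trans ?_
  -- the set of rounded ordinates
  set Kr := ((weilZeroIndex_finite T).toFinset).image (fun ρ ↦ round ρ.im) with hKr
  have hKmem : ∀ k ∈ Kr, |(k : ℝ)| ≤ T + 1 / 2 := by
    intro k hk
    obtain ⟨ρ, hρ, rfl⟩ := Finset.mem_image.1 hk
    have h1 : |ρ.im - round ρ.im| ≤ 1 / 2 := abs_sub_round ρ.im
    have h2 := (mem_WT hρ).2.1
    have := abs_sub_abs_le_abs_sub (((round ρ.im : ℤ) : ℝ)) ρ.im
    rw [abs_sub_comm] at h1
    linarith
  set N : ℕ := ⌊2 * T⌋₊ + 1 with hN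
  have hKN : ∀ k ∈ Kr, |(k : ℝ) - t| < N + 1 := by
    intro k hk
    have h1 := hKmem k hk
    have h2 : |(k : ℝ) - t| ≤ |(k : ℝ)| + |t| := abs_sub _ _
    have h3 : (2 * T : ℝ) < ⌊2 * T⌋₊ + 1 := Nat.lt_floor_add_one _
    rw [hN]; push_cast
    linarith
  have hS := sum_inv_one_add_abs_sub_le Kr t N hKN
  have hN2 : Real.log ((N : ℝ) + 2) ≤ 3 * Real.log T := by
    have h1 : (N : ℝ) + 2 ≤ 2 * T + 3 := by
      rw [hN]; push_cast; linarith [Nat.floor_le (by linarith : (0 : ℝ) ≤ 2 * T)]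
    exact (Real.log_le_log (by positivity) h1).trans hlogA
  have hlogk : ∀ k ∈ Kr, Real.log (|(k : ℝ)| + 2) ≤ 3 * Real.log T := by
    intro k hk
    have := hKmem k hk
    exact (Real.log_le_log (by positivity) (by linarith)).trans hlogA
  calc Cw * ∑ k ∈ Kr, wt k * Real.log (|(k : ℝ)| + 2)
      ≤ Cw * ∑ k ∈ Kr, wt k * (3 * Real.log T) := by
        refine mul_le_mul_of_nonneg_left (Finset.sum_le_sum fun k hk ↦ ?_) hCw0.le
        exact mul_le_mul_of_nonneg_left (hlogk k hk) (hwt0 k)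
    _ = Cw * (3 * Real.log T) * (2 * ∑ k ∈ Kr, 1 / (1 + |(k : ℝ) - t|)) := by
        rw [← Finset.sum_mul, Finset.mul_sum]
        simp only [hwt]
        have : ∀ k ∈ Kr, 2 / (1 + |(k : ℝ) - t|) = 2 * (1 / (1 + |(k : ℝ) - t|)) := fun k _ ↦ by ring
        rw [Finset.sum_congr rfl this]
        ring
    _ ≤ Cw * (3 * Real.log T) * (2 * (2 * (1 + Real.log (N + 2)))) := by gcongr
    _ ≤ Cw * (3 * Real.log T) * (2 * (2 * (5 * Real.log T))) := by gcongr; linarith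
    _ = 60 * Cw * Real.log T ^ 2 := by ring

/-- `‖1 + ρ₁ + conj ρ₂‖ ≥ (1 + |γ₂ − γ₁|)/2` when `Re ρ₁, Re ρ₂ ≥ 0`. [folklore] -/
private theorem norm_one_add_add_conj_ge {ρ₁ ρ₂ : ℂ} (h₁ : 0 ≤ ρ₁.re) (h₂ : 0 ≤ ρ₂.re) :
    (1 + |ρ₂.im - ρ₁.im|) / 2 ≤ ‖1 + ρ₁ + conj ρ₂‖ := by
  set z := 1 + ρ₁ + conj ρ₂ with hz
  have hre : z.re = 1 + ρ₁.re + ρ₂.re := by simp [hz]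
  have him : z.im = ρ₁.im - ρ₂.im := by simp [hz]; ring
  have h1 : 1 ≤ ‖z‖ := by
    have := Complex.abs_re_le_norm z
    rw [hre, abs_of_nonneg (by linarith)] at this
    linarith
  have h2 : |ρ₂.im - ρ₁.im| ≤ ‖z‖ := by
    have := Complex.abs_im_le_norm z
    rwa [him, abs_sub_comm] at this
  linarith

/-- **The kernel sum**: there is `C > 0` such that for `T ≥ 2` and `ρ₁ ∈ W_T`,
`Σ_{ρ₂ ∈ W_T} m(ρ₂)/‖1 + ρ₁ + conj ρ₂‖ ≤ C log² T`. [cite: GuthMaynard2026, §13.2, proof of Corollary 1.4, arXiv p0029:L30–L62] -/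
theorem exists_kernelSum_le : ∃ C : ℝ, 0 < C ∧ ∀ T : ℝ, 2 ≤ T → ∀ ρ₁ ∈ (weilZeroIndex_finite T).toFinset,
    ∑ ρ₂ ∈ (weilZeroIndex_finite T).toFinset, (riemannZetaZeroOrder ρ₂ : ℝ) * (1 / ‖1 + ρ₁ + conj ρ₂‖) ≤ C * Real.log T ^ 2 := by
  obtain ⟨C, hC0, hC⟩ := exists_sum_order_div_one_add_abs_le
  refine ⟨2 * C, by positivity, fun T hT ρ₁ h₁ ↦ ?_⟩
  have hm1 := mem_WT h₁
  have h := hC T hT ρ₁.im hm1.2.1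
  calc ∑ ρ₂ ∈ (weilZeroIndex_finite T).toFinset, (riemannZetaZeroOrder ρ₂ : ℝ) * (1 / ‖1 + ρ₁ + conj ρ₂‖)
      ≤ ∑ ρ₂ ∈ (weilZeroIndex_finite T).toFinset, (riemannZetaZeroOrder ρ₂ : ℝ) * (2 * (1 / (1 + |ρ₂.im - ρ₁.im|))) := by
        refine Finset.sum_le_sum fun ρ₂ h₂ ↦ ?_
        have hm2 := mem_WT h₂
        refine mul_le_mul_of_nonneg_left ?_ (order_nonneg_of_mem_WT h₂)
        have hk := norm_one_add_add_conj_ge hm1.2.2.1.le hm2.2.2.1.le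
        have hpos : 0 < (1 + |ρ₂.im - ρ₁.im|) / 2 := by positivity
        rw [show 2 * (1 / (1 + |ρ₂.im - ρ₁.im|)) = 1 / ((1 + |ρ₂.im - ρ₁.im|) / 2) by
          field_simp]
        exact one_div_le_one_div_of_le hpos hk
    _ = 2 * ∑ ρ₂ ∈ (weilZeroIndex_finite T).toFinset, (riemannZetaZeroOrder ρ₂ : ℝ) * (1 / (1 + |ρ₂.im - ρ₁.im|)) := by
        rw [Finset.mul_sum]; refine Finset.sum_congr rfl fun _ _ ↦ by ring
    _ ≤ 2 * (C * Real.log T ^ 2) := by gcongr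
    _ = 2 * C * Real.log T ^ 2 := by ring

/-! ### §7 Counting: bins in `σ`, the two-sided count, the total count -/

/-- **Binning in `σ`** (GM: "by considering `1/log x`-separated values of `σ`"): for `X > 1` and
an integer `L ≥ log X`,
`Σ_{ρ ∈ W_T} m(ρ) X^{2Re ρ} ≤ e² Σ_{j < L} X^{2j/L} Σ_{ρ ∈ W_T, Re ρ ≥ j/L} m(ρ)`. [cite: GuthMaynard2026, §13.2, proof of Corollary 1.3, arXiv p0029:L3–L28] -/
theorem sum_order_mul_rpow_le_bins (T : ℝ) {X : ℝ} (hX : 1 < X) {L : ℕ} (hL0 : 0 < L)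
    (hL : Real.log X ≤ L) :
    ∑ ρ ∈ (weilZeroIndex_finite T).toFinset, (riemannZetaZeroOrder ρ : ℝ) * X ^ (2 * ρ.re) ≤
      Real.exp 2 * ∑ j ∈ Finset.range L, X ^ (2 * (j : ℝ) / L) *
        ∑ ρ ∈ (weilZeroIndex_finite T).toFinset with (j : ℝ) / L ≤ ρ.re, (riemannZetaZeroOrder ρ : ℝ) := by
  have hX0 : 0 < X := by linarith
  have hL0' : (0 : ℝ) < L := by exact_mod_cast hL0
  have hlogX : 0 < Real.log X := Real.log_pos hX
  -- the bin index
  set bin : ℂ → ℕ := fun ρ ↦ ⌊ρ.re * L⌋₊ with hbin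
  have hmaps : ∀ ρ ∈ (weilZeroIndex_finite T).toFinset, bin ρ ∈ Finset.range L := by
    intro ρ hρ
    have h := mem_WT hρ
    rw [Finset.mem_range, hbin]
    refine (Nat.floor_lt (by nlinarith [h.2.2.1])).2 ?_
    calc ρ.re * L < 1 * L := mul_lt_mul_of_pos_right h.2.2.2 hL0'
      _ = L := one_mul _
  -- `X^{2β} ≤ e² X^{2 bin/L}`
  have hpow : ∀ ρ ∈ (weilZeroIndex_finite T).toFinset, X ^ (2 * ρ.re) ≤ Real.exp 2 * X ^ (2 * (bin ρ : ℝ) / L) := by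
    intro ρ hρ
    have h := mem_WT hρ
    have hb : ρ.re * L < (bin ρ : ℝ) + 1 := Nat.lt_floor_add_one _
    have h1 : 2 * ρ.re ≤ 2 * (bin ρ : ℝ) / L + 2 / L := by
      rw [← add_div, le_div_iff₀ hL0']; linarith
    have h2 : X ^ (2 * ρ.re) ≤ X ^ (2 * (bin ρ : ℝ) / L + 2 / L) :=
      Real.rpow_le_rpow_of_exponent_le hX.le h1
    have h3 : X ^ (2 / (L : ℝ)) ≤ Real.exp 2 := by
      rw [Real.rpow_def_of_pos hX0, Real.exp_le_exp]
      rw [show Real.log X * (2 / L) = 2 * (Real.log X / L) by ring]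
      have : Real.log X / L ≤ 1 := by rw [div_le_one hL0']; exact hL
      linarith
    rw [Real.rpow_add hX0] at h2
    calc X ^ (2 * ρ.re) ≤ X ^ (2 * (bin ρ : ℝ) / L) * X ^ (2 / (L : ℝ)) := h2
      _ ≤ X ^ (2 * (bin ρ : ℝ) / L) * Real.exp 2 :=
          mul_le_mul_of_nonneg_left h3 (Real.rpow_nonneg hX0.le _)
      _ = Real.exp 2 * X ^ (2 * (bin ρ : ℝ) / L) := mul_comm _ _
  rw [← Finset.sum_fiberwise_of_maps_to hmaps, Finset.mul_sum]
  refine Finset.sum_le_sum fun j hj ↦ ?_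
  calc ∑ ρ ∈ (weilZeroIndex_finite T).toFinset with bin ρ = j, (riemannZetaZeroOrder ρ : ℝ) * X ^ (2 * ρ.re)
      ≤ ∑ ρ ∈ (weilZeroIndex_finite T).toFinset with bin ρ = j,
          (riemannZetaZeroOrder ρ : ℝ) * (Real.exp 2 * X ^ (2 * (j : ℝ) / L)) := by
        refine Finset.sum_le_sum fun ρ hρ ↦ ?_
        rw [Finset.mem_filter] at hρ
        have := hpow ρ hρ.1
        rw [hρ.2] at this
        exact mul_le_mul_of_nonneg_left this (order_nonneg_of_mem_WT hρ.1)
    _ = Real.exp 2 * X ^ (2 * (j : ℝ) / L) *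
          ∑ ρ ∈ (weilZeroIndex_finite T).toFinset with bin ρ = j, (riemannZetaZeroOrder ρ : ℝ) := by
        rw [Finset.mul_sum]; refine Finset.sum_congr rfl fun _ _ ↦ by ring
    _ ≤ Real.exp 2 * X ^ (2 * (j : ℝ) / L) *
          ∑ ρ ∈ (weilZeroIndex_finite T).toFinset with (j : ℝ) / L ≤ ρ.re, (riemannZetaZeroOrder ρ : ℝ) := by
        refine mul_le_mul_of_nonneg_left ?_ (by positivity)
        refine Finset.sum_le_sum_of_subset_of_nonneg ?_ fun ρ hρ _ ↦
          order_nonneg_of_mem_WT (Finset.mem_filter.1 hρ).1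
        intro ρ hρ
        rw [Finset.mem_filter] at hρ ⊢
        refine ⟨hρ.1, ?_⟩
        have : (bin ρ : ℝ) ≤ ρ.re * L := Nat.floor_le (by nlinarith [(mem_WT hρ.1).2.2.1])
        rw [hρ.2] at this
        rw [div_le_iff₀ hL0']; exact this
    _ = Real.exp 2 * (X ^ (2 * (j : ℝ) / L) *
          ∑ ρ ∈ (weilZeroIndex_finite T).toFinset with (j : ℝ) / L ≤ ρ.re, (riemannZetaZeroOrder ρ : ℝ)) := by ring

/-- **The two-sided count**: `Σ_{ρ ∈ W_T, Re ρ ≥ σ} m(ρ) ≤ 2 N(σ, T)` (the lower-half zeros are the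
conjugates of the upper-half ones, with the same multiplicity). [cite: Titchmarsh1986, §9.1] -/
theorem sum_order_filter_le_two_mul_count (σ T : ℝ) :
    ∑ ρ ∈ (weilZeroIndex_finite T).toFinset with σ ≤ ρ.re, (riemannZetaZeroOrder ρ : ℝ) ≤ 2 * (zetaZeroCountRe σ T : ℝ) := by
  classical
  rw [natCast_zetaZeroCountRe]
  set B := (zetaZeroBox_finite σ T).toFinset with hB
  set F := ((weilZeroIndex_finite T).toFinset).filter fun ρ ↦ σ ≤ ρ.re with hF
  have hBnn : ∀ ρ ∈ B, (0 : ℝ) ≤ (riemannZetaZeroOrder ρ : ℝ) := fun ρ hρ ↦ by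
    rw [hB, Set.Finite.mem_toFinset] at hρ
    exact_mod_cast riemannZetaZeroOrder_nonneg_of_mem_zetaZeroBox hρ
  have hmemF : ∀ ρ ∈ F, riemannZeta ρ = 0 ∧ σ ≤ ρ.re ∧ ρ.re ≤ 1 ∧ ρ.im ≠ 0 ∧ |ρ.im| ≤ T := by
    intro ρ hρ
    rw [hF, Finset.mem_filter, Set.Finite.mem_toFinset] at hρ
    exact ⟨hρ.1.1, hρ.2, hρ.1.2.2.1, hρ.1.2.2.2.1, hρ.1.2.2.2.2⟩
  rw [← Finset.sum_filter_add_sum_filter_not F (fun ρ ↦ 0 < ρ.im)]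
  -- upper half ⊆ box
  have h1 : ∑ ρ ∈ F with 0 < ρ.im, (riemannZetaZeroOrder ρ : ℝ) ≤
      ∑ ρ ∈ B, (riemannZetaZeroOrder ρ : ℝ) := by
    refine Finset.sum_le_sum_of_subset_of_nonneg (fun ρ hρ ↦ ?_) fun ρ hρ _ ↦ hBnn ρ hρ
    rw [Finset.mem_filter] at hρ
    obtain ⟨h0, hs, h1', hne, habs⟩ := hmemF ρ hρ.1
    rw [hB, Set.Finite.mem_toFinset]
    exact ⟨h0, hs, h1', hρ.2, (le_abs_self _).trans habs⟩
  -- lower half: conjugate into the box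
  have h2 : ∑ ρ ∈ F with ¬ 0 < ρ.im, (riemannZetaZeroOrder ρ : ℝ) ≤
      ∑ ρ ∈ B, (riemannZetaZeroOrder ρ : ℝ) := by
    set G := F.filter fun ρ ↦ ¬ 0 < ρ.im with hG
    have hinj : Set.InjOn (fun ρ : ℂ ↦ conj ρ) G := fun a _ b _ hab ↦ by
      simpa using congrArg conj hab
    have e : ∑ ρ ∈ G, (riemannZetaZeroOrder ρ : ℝ) =
        ∑ ρ ∈ G.image (fun ρ : ℂ ↦ conj ρ), (riemannZetaZeroOrder ρ : ℝ) := by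
      rw [Finset.sum_image hinj]
      refine Finset.sum_congr rfl fun ρ _ ↦ ?_
      rw [riemannZetaZeroOrder_conj_holds ρ]
    rw [e]
    refine Finset.sum_le_sum_of_subset_of_nonneg (fun w hw ↦ ?_) fun ρ hρ _ ↦ hBnn ρ hρ
    obtain ⟨ρ, hρ, rfl⟩ := Finset.mem_image.1 hw
    rw [hG, Finset.mem_filter] at hρ
    obtain ⟨h0, hs, h1', hne, habs⟩ := hmemF ρ hρ.1
    have hneg : ρ.im < 0 := lt_of_le_of_ne (not_lt.1 hρ.2) hne
    rw [hB, Set.Finite.mem_toFinset]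
    refine ⟨?_, ?_, ?_, ?_, ?_⟩
    · rw [riemannZeta_conj, h0, map_zero]
    · simpa using hs
    · simpa using h1'
    · simpa using hneg
    · rw [Complex.conj_im]; exact (neg_le_abs _).trans (by simpa [abs_neg] using habs)
  linarith

/-- **The total count `Σ_{|γ| ≤ T} m(ρ) ≪ T log T`** (Riemann–von Mangoldt order of magnitude,
from the unit-window counts): there is `C > 0` with `Σ_{ρ ∈ W_T} m(ρ) ≤ C T log T` for `T ≥ 2`. [cite: MontgomeryVaughan2007, Thm. 10.13] -/
theorem exists_sum_order_le : ∃ C : ℝ, 0 < C ∧ ∀ T : ℝ, 2 ≤ T →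
    ∑ ρ ∈ (weilZeroIndex_finite T).toFinset, (riemannZetaZeroOrder ρ : ℝ) ≤ C * T * Real.log T := by
  obtain ⟨Cw, hCw0, hCw⟩ := ZeroOrdinateSums.exists_sum_le_of_abs_im_sub_le
  refine ⟨12 * Cw, by positivity, fun T hT ↦ ?_⟩
  have hT0 : 0 < T := by linarith
  obtain ⟨hlogA, hlogB⟩ := log_aux hT
  have hF : ∀ ρ ∈ (weilZeroIndex_finite T).toFinset, ρ ∈ ZetaZeros.riemannZetaNontrivialZeros := fun ρ h ↦ (mem_WT h).1
  have h := @ZeroOrdinateSums.sum_mul_le_of_ordinate_majorant Cw hCw (fun _ ↦ (1 : ℝ))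
    (fun _ ↦ (1 : ℝ)) (fun _ ↦ zero_le_one) ((weilZeroIndex_finite T).toFinset) hF (fun _ _ ↦ le_rfl)
  simp only [mul_one, one_mul] at h
  refine h.trans ?_
  set Kr := ((weilZeroIndex_finite T).toFinset).image (fun ρ ↦ round ρ.im) with hKr
  have hKmem : ∀ k ∈ Kr, |(k : ℝ)| ≤ T + 1 / 2 := by
    intro k hk
    obtain ⟨ρ, hρ, rfl⟩ := Finset.mem_image.1 hk
    have h1 : |ρ.im - round ρ.im| ≤ 1 / 2 := abs_sub_round ρ.im
    have h2 := (mem_WT hρ).2.1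
    have := abs_sub_abs_le_abs_sub (((round ρ.im : ℤ) : ℝ)) ρ.im
    rw [abs_sub_comm] at h1
    linarith
  have hcard : (Kr.card : ℝ) ≤ 4 * T := by
    have hc := ZeroOrdinateSums.card_filter_abs_sub_lt_le Kr 0 (T + 1) (by linarith)
    have hfilt : Kr.filter (fun k : ℤ ↦ |(k : ℝ) - 0| < T + 1) = Kr := by
      refine Finset.filter_true_of_mem fun k hk ↦ ?_
      rw [sub_zero]; linarith [hKmem k hk]
    rw [hfilt] at hc
    linarith
  have hlogk : ∀ k ∈ Kr, Real.log (|(k : ℝ)| + 2) ≤ 3 * Real.log T := by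
    intro k hk
    have := hKmem k hk
    exact (Real.log_le_log (by positivity) (by linarith)).trans hlogA
  calc Cw * ∑ k ∈ Kr, Real.log (|(k : ℝ)| + 2) ≤ Cw * ∑ k ∈ Kr, 3 * Real.log T :=
        mul_le_mul_of_nonneg_left (Finset.sum_le_sum hlogk) hCw0.le
    _ = Cw * (Kr.card * (3 * Real.log T)) := by rw [Finset.sum_const, nsmul_eq_mul]
    _ ≤ Cw * (4 * T * (3 * Real.log T)) := by
        have : 0 ≤ Real.log T := by linarith
        gcongr
    _ = 12 * Cw * T * Real.log T := by ring

/-! ### §8 The density-free mean-square bound -/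

/-- `(ψ(x + δx) − ψ(x) − δx)²` is interval integrable on `[X, b]` (`0 ≤ X ≤ b`, `δ ≥ 0`): bounded and
measurable (`ψ` is monotone). [folklore] -/
private theorem intervalIntegrable_sq_psiShift {X b δ : ℝ} (hX : 0 ≤ X) (hXb : X ≤ b) (hδ : 0 ≤ δ) :
    IntervalIntegrable (fun x ↦ (ψ (x + δ * x) - ψ x - δ * x) ^ 2) volume X b := by
  rw [intervalIntegrable_iff_integrableOn_Ioc_of_le hXb]
  have hm1 : Measurable fun x : ℝ ↦ ψ (x + δ * x) :=
    Chebyshev.psi_mono.measurable.comp (measurable_id.add (measurable_const.mul measurable_id))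
  have hmeas : Measurable fun x : ℝ ↦ (ψ (x + δ * x) - ψ x - δ * x) ^ 2 :=
    ((hm1.sub Chebyshev.psi_mono.measurable).sub (measurable_const.mul measurable_id)).pow_const 2
  set Bd : ℝ := ψ (b + δ * b) + ψ b + δ * b with hBd
  have hb0 : 0 ≤ b := hX.trans hXb
  have hBd0 : 0 ≤ Bd := by
    have h1 := Chebyshev.psi_nonneg (b + δ * b)
    have h2 := Chebyshev.psi_nonneg b
    have h3 : 0 ≤ δ * b := mul_nonneg hδ hb0
    rw [hBd]; linarith
  refine MeasureTheory.Measure.integrableOn_of_bounded (M := Bd ^ 2) (by simp)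
    hmeas.aestronglyMeasurable ?_
  refine (MeasureTheory.ae_restrict_iff' measurableSet_Ioc).2 (Filter.Eventually.of_forall fun y hy ↦ ?_)
  have hy0 : 0 ≤ y := hX.trans hy.1.le
  have hψ1 : ψ (y + δ * y) ≤ ψ (b + δ * b) := Chebyshev.psi_mono (by nlinarith [hy.2])
  have hψ2 : ψ y ≤ ψ b := Chebyshev.psi_mono hy.2
  have hψ3 := Chebyshev.psi_nonneg y
  have hψ4 := Chebyshev.psi_nonneg (y + δ * y)
  have hδy : δ * y ≤ δ * b := mul_le_mul_of_nonneg_left hy.2 hδ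
  have hδy0 : 0 ≤ δ * y := mul_nonneg hδ hy0
  rw [Real.norm_eq_abs, abs_pow, ← sq_abs Bd]
  refine pow_le_pow_left₀ (abs_nonneg _) ?_ 2
  rw [abs_of_nonneg hBd0, abs_le]
  constructor <;> linarith

/-- Elementary logarithms for `6 ≤ X`, `2 ≤ T ≤ X`: `log(6X) ≤ 2 log X`, `log(6XT) ≤ 3 log X`,
`log T ≤ log X`, `1 ≤ log X`. [folklore] -/
private theorem log_aux₂ {X T : ℝ} (hX : 6 ≤ X) (hT : 2 ≤ T) (hTX : T ≤ X) :
    Real.log (6 * X) ≤ 2 * Real.log X ∧ Real.log (6 * X * T) ≤ 3 * Real.log X ∧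
      Real.log T ≤ Real.log X ∧ 1 ≤ Real.log X := by
  have hX0 : 0 < X := by linarith
  have hT0 : 0 < T := by linarith
  refine ⟨?_, ?_, Real.log_le_log hT0 hTX, ?_⟩
  · rw [← Real.log_rpow hX0, Real.rpow_two]
    exact Real.log_le_log (by linarith) (by nlinarith)
  · have e : Real.log (X ^ 3) = 3 * Real.log X := by rw [Real.log_pow]; norm_num
    rw [← e]
    refine Real.log_le_log (by positivity) ?_
    have h1 : 6 * X * T ≤ 6 * (X * X) := by nlinarith
    have h2 : 6 * (X * X) ≤ X * (X * X) :=
      mul_le_mul_of_nonneg_right hX (mul_nonneg hX0.le hX0.le)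
    have e3 : X ^ 3 = X * (X * X) := by ring
    rw [e3]; linarith
  · rw [Real.le_log_iff_exp_le hX0]
    have := Real.exp_one_lt_d9; linarith

/-- The remainder constant of the differenced explicit formula on `[X, 3X]`, squared:
with `L = log X ≥ 0` and `2 ≤ T ≤ X`, `X ≥ 6`,
`(2M(log 6X + (6X/T) log²(6XT)))² ≤ 32M²L² + 23328 M² X² L⁴/T²`. [folklore] -/
private theorem remainder_sq_le {M X T : ℝ} (hM0 : 0 ≤ M) (hX : 6 ≤ X) (hT : 2 ≤ T) (hTX : T ≤ X) :
    (2 * (M * (Real.log (6 * X) + 6 * X / T * Real.log (6 * X * T) ^ 2))) ^ 2 ≤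
      32 * M ^ 2 * Real.log X ^ 2 + 23328 * M ^ 2 * X ^ 2 * Real.log X ^ 4 / T ^ 2 := by
  have hX0 : 0 < X := by linarith
  have hT0 : 0 < T := by linarith
  obtain ⟨hlog6, hlog6T, -, hlog1⟩ := log_aux₂ hX hT hTX
  set L := Real.log X with hL
  set R := 2 * (M * (Real.log (6 * X) + 6 * X / T * Real.log (6 * X * T) ^ 2)) with hR
  have hl6 : 0 ≤ Real.log (6 * X) := Real.log_nonneg (by linarith)
  have hl6T : 0 ≤ Real.log (6 * X * T) := Real.log_nonneg (by nlinarith)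
  have hR0 : 0 ≤ R := by
    rw [hR]; exact mul_nonneg two_pos.le (mul_nonneg hM0 (add_nonneg hl6 (by positivity)))
  have hRle : R ≤ 4 * M * L + 108 * M * X * L ^ 2 / T := by
    have h1 : 6 * X / T * Real.log (6 * X * T) ^ 2 ≤ 6 * X / T * (3 * L) ^ 2 := by gcongr
    have h2 : M * (Real.log (6 * X) + 6 * X / T * Real.log (6 * X * T) ^ 2) ≤
        M * (2 * L + 6 * X / T * (3 * L) ^ 2) := by gcongr
    have e : 2 * (M * (2 * L + 6 * X / T * (3 * L) ^ 2)) = 4 * M * L + 108 * M * X * L ^ 2 / T := by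
      ring
    rw [hR]; linarith
  have h1 : R ^ 2 ≤ (4 * M * L + 108 * M * X * L ^ 2 / T) ^ 2 := pow_le_pow_left₀ hR0 hRle 2
  have h2 : (4 * M * L + 108 * M * X * L ^ 2 / T) ^ 2 ≤
      2 * (4 * M * L) ^ 2 + 2 * (108 * M * X * L ^ 2 / T) ^ 2 := by
    nlinarith [sq_nonneg (4 * M * L - 108 * M * X * L ^ 2 / T)]
  have e : 2 * (4 * M * L) ^ 2 + 2 * (108 * M * X * L ^ 2 / T) ^ 2 =
      32 * M ^ 2 * L ^ 2 + 23328 * M ^ 2 * X ^ 2 * L ^ 4 / T ^ 2 := by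
    rw [div_pow]; ring
  linarith

/-- **The double sum over pairs of zeros**: if `‖a_ρ‖ ≤ m(ρ) δ` on `W_T` (`T ≥ 2`, `X > 0`, `δ ≥ 0`,
`log T ≤ L`, `0 ≤ log T`) then, with the kernel-sum constant `C_K`,
`Σ_{ρ₁,ρ₂ ∈ W_T} ‖a₁‖‖a₂‖ · 28X^{β₁+β₂+1}/‖1+ρ₁+conj ρ₂‖ ≤ 28 δ² X · C_K L² · Σ_{ρ ∈ W_T} m(ρ) X^{2β}`.
[cite: GuthMaynard2026, §13.2, proof of Corollary 1.4, arXiv p0029:L30–L62] -/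
theorem doubleSum_le {CK : ℝ} (hCK0 : 0 < CK)
    (hCK : ∀ T : ℝ, 2 ≤ T → ∀ ρ₁ ∈ (weilZeroIndex_finite T).toFinset,
      ∑ ρ₂ ∈ (weilZeroIndex_finite T).toFinset,
        (riemannZetaZeroOrder ρ₂ : ℝ) * (1 / ‖1 + ρ₁ + conj ρ₂‖) ≤ CK * Real.log T ^ 2)
    {T X δ L : ℝ} (hT : 2 ≤ T) (hX0 : 0 < X) (hδ0 : 0 ≤ δ) (hLT : Real.log T ≤ L)
    (hlogT0 : 0 ≤ Real.log T) (a : ℂ → ℂ)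
    (ha_le : ∀ ρ ∈ (weilZeroIndex_finite T).toFinset, ‖a ρ‖ ≤ (riemannZetaZeroOrder ρ : ℝ) * δ) :
    ∑ ρ₁ ∈ (weilZeroIndex_finite T).toFinset, ∑ ρ₂ ∈ (weilZeroIndex_finite T).toFinset,
        ‖a ρ₁‖ * ‖a ρ₂‖ * (28 * X ^ (ρ₁.re + ρ₂.re + 1) / ‖1 + ρ₁ + conj ρ₂‖) ≤
      28 * δ ^ 2 * X * (CK * L ^ 2 *
        ∑ ρ ∈ (weilZeroIndex_finite T).toFinset, (riemannZetaZeroOrder ρ : ℝ) * X ^ (2 * ρ.re)) := by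
  set F := (weilZeroIndex_finite T).toFinset with hF
  set K : ℂ → ℂ → ℝ := fun ρ₁ ρ₂ ↦ 1 / ‖1 + ρ₁ + conj ρ₂‖ with hK
  have hK0 : ∀ ρ₁ ∈ F, ∀ ρ₂ ∈ F, 0 ≤ K ρ₁ ρ₂ := fun _ _ _ _ ↦ by positivity
  have hKsymm : ∀ ρ₁ ∈ F, ∀ ρ₂ ∈ F, K ρ₁ ρ₂ = K ρ₂ ρ₁ := by
    intro ρ₁ _ ρ₂ _
    simp only [hK]
    rw [show 1 + ρ₂ + conj ρ₁ = conj (1 + ρ₁ + conj ρ₂) by simp; ring, Complex.norm_conj]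
  have hI4 : ∑ ρ₁ ∈ F, ∑ ρ₂ ∈ F, ‖a ρ₁‖ * ‖a ρ₂‖ * (28 * X ^ (ρ₁.re + ρ₂.re + 1) / ‖1 + ρ₁ + conj ρ₂‖)
      ≤ 28 * δ ^ 2 * X * ∑ ρ₁ ∈ F, ∑ ρ₂ ∈ F,
          (riemannZetaZeroOrder ρ₁ : ℝ) * (riemannZetaZeroOrder ρ₂ : ℝ) *
            (X ^ ρ₁.re * X ^ ρ₂.re) * K ρ₁ ρ₂ := by
    rw [Finset.mul_sum]
    refine Finset.sum_le_sum fun ρ₁ h₁ ↦ ?_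
    rw [Finset.mul_sum]
    refine Finset.sum_le_sum fun ρ₂ h₂ ↦ ?_
    have hpow : X ^ (ρ₁.re + ρ₂.re + 1) = X ^ ρ₁.re * X ^ ρ₂.re * X := by
      rw [Real.rpow_add hX0, Real.rpow_add hX0, Real.rpow_one]
    have hm1 := order_nonneg_of_mem_WT h₁
    have hm2 := order_nonneg_of_mem_WT h₂
    have hKnn := hK0 ρ₁ h₁ ρ₂ h₂
    have hx1 : 0 ≤ X ^ ρ₁.re := Real.rpow_nonneg hX0.le _
    have hx2 : 0 ≤ X ^ ρ₂.re := Real.rpow_nonneg hX0.le _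
    have h12 : ‖a ρ₁‖ * ‖a ρ₂‖ ≤ (riemannZetaZeroOrder ρ₁ : ℝ) * δ * ((riemannZetaZeroOrder ρ₂ : ℝ) * δ) :=
      mul_le_mul (ha_le ρ₁ h₁) (ha_le ρ₂ h₂) (norm_nonneg _) (by positivity)
    calc ‖a ρ₁‖ * ‖a ρ₂‖ * (28 * X ^ (ρ₁.re + ρ₂.re + 1) / ‖1 + ρ₁ + conj ρ₂‖)
        = ‖a ρ₁‖ * ‖a ρ₂‖ * (28 * (X ^ ρ₁.re * X ^ ρ₂.re * X) * K ρ₁ ρ₂) := by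
          rw [hpow]; simp only [hK]; ring
      _ ≤ (riemannZetaZeroOrder ρ₁ : ℝ) * δ * ((riemannZetaZeroOrder ρ₂ : ℝ) * δ) *
            (28 * (X ^ ρ₁.re * X ^ ρ₂.re * X) * K ρ₁ ρ₂) :=
          mul_le_mul_of_nonneg_right h12 (by positivity)
      _ = 28 * δ ^ 2 * X * ((riemannZetaZeroOrder ρ₁ : ℝ) * (riemannZetaZeroOrder ρ₂ : ℝ) *
            (X ^ ρ₁.re * X ^ ρ₂.re) * K ρ₁ ρ₂) := by ring
  have hI5 : ∑ ρ₁ ∈ F, ∑ ρ₂ ∈ F,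
          (riemannZetaZeroOrder ρ₁ : ℝ) * (riemannZetaZeroOrder ρ₂ : ℝ) *
            (X ^ ρ₁.re * X ^ ρ₂.re) * K ρ₁ ρ₂
      ≤ ∑ ρ₁ ∈ F, (riemannZetaZeroOrder ρ₁ : ℝ) * (X ^ ρ₁.re) ^ 2 *
          ∑ ρ₂ ∈ F, (riemannZetaZeroOrder ρ₂ : ℝ) * K ρ₁ ρ₂ :=
    sum_sum_le_of_symm F (fun ρ ↦ (riemannZetaZeroOrder ρ : ℝ)) (fun ρ ↦ X ^ ρ.re) K
      (fun ρ h ↦ order_nonneg_of_mem_WT h) hK0 hKsymm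
  have hI6 : ∑ ρ₁ ∈ F, (riemannZetaZeroOrder ρ₁ : ℝ) * (X ^ ρ₁.re) ^ 2 *
          ∑ ρ₂ ∈ F, (riemannZetaZeroOrder ρ₂ : ℝ) * K ρ₁ ρ₂
      ≤ ∑ ρ₁ ∈ F, (riemannZetaZeroOrder ρ₁ : ℝ) * X ^ (2 * ρ₁.re) * (CK * L ^ 2) := by
    refine Finset.sum_le_sum fun ρ₁ h₁ ↦ ?_
    have hm1 := order_nonneg_of_mem_WT h₁
    have hsq : (X ^ ρ₁.re) ^ 2 = X ^ (2 * ρ₁.re) := by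
      rw [← Real.rpow_natCast, ← Real.rpow_mul hX0.le]; norm_num; ring_nf
    rw [hsq]
    have hk' : ∑ ρ₂ ∈ F, (riemannZetaZeroOrder ρ₂ : ℝ) * K ρ₁ ρ₂ ≤ CK * L ^ 2 :=
      (hCK T hT ρ₁ h₁).trans (mul_le_mul_of_nonneg_left (pow_le_pow_left₀ hlogT0 hLT 2) hCK0.le)
    exact mul_le_mul_of_nonneg_left hk' (mul_nonneg hm1 (Real.rpow_nonneg hX0.le _))
  have hI7 : ∑ ρ₁ ∈ F, (riemannZetaZeroOrder ρ₁ : ℝ) * X ^ (2 * ρ₁.re) * (CK * L ^ 2) =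
      CK * L ^ 2 * ∑ ρ ∈ F, (riemannZetaZeroOrder ρ : ℝ) * X ^ (2 * ρ.re) := by
    rw [Finset.mul_sum]; refine Finset.sum_congr rfl fun _ _ ↦ by ring
  refine hI4.trans (mul_le_mul_of_nonneg_left ?_ (by positivity))
  exact hI5.trans (hI7 ▸ hI6)

/-- **The mean square of `ψ(x + δx) − ψ(x) − δx` over `[X, 3X]` in terms of the zeros up to height
`T`** (Guth–Maynard §13, proof of Cor. 1.4, the steps "Applying the explicit formula … Expanding
the sum, and performing the integral over `x` … `Σ_{|ρ₂|<T}|1+z+conj ρ₂|⁻¹ ≪ (log T)²", made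
unconditional and density-free): there is `C > 0` such that for `X ≥ 6`, `0 ≤ δ ≤ 1`,
`2 ≤ T ≤ X`,
`∫_X^{3X} (ψ(x+δx) − ψ(x) − δx)² dx ≤ C (δ² X log²X · Σ_{|γ|≤T} m(ρ) X^{2Re ρ} + X log²X + X³ log⁴X/T²)`.
[cite: GuthMaynard2026, §13.2, proof of Corollary 1.4, arXiv p0029:L30–L62] -/
theorem exists_meanSquare_le_zeroSum : ∃ C : ℝ, 0 < C ∧ ∀ X : ℝ, 6 ≤ X → ∀ δ : ℝ, 0 ≤ δ → δ ≤ 1 →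
    ∀ T : ℝ, 2 ≤ T → T ≤ X →
    ∫ x in X..(3 * X), (ψ (x + δ * x) - ψ x - δ * x) ^ 2 ≤
      C * (δ ^ 2 * X * Real.log X ^ 2 *
            ∑ ρ ∈ (weilZeroIndex_finite T).toFinset, (riemannZetaZeroOrder ρ : ℝ) * X ^ (2 * ρ.re)
          + X * Real.log X ^ 2 + X ^ 3 * Real.log X ^ 4 / T ^ 2) := by
  obtain ⟨M, hM0, hM⟩ := exists_norm_psi_sub_add_zeroSum_le
  obtain ⟨CK, hCK0, hCK⟩ := exists_kernelSum_le
  refine ⟨56 * CK + 93440 * M ^ 2 + 1, by positivity, fun X hX δ hδ0 hδ1 T hT hTX ↦ ?_⟩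
  have hX0 : 0 < X := by linarith
  have hX3 : X ≤ 3 * X := by linarith
  have hT0 : 0 < T := by linarith
  obtain ⟨-, -, hlogTX, hlog1⟩ := log_aux₂ hX hT hTX
  have hlogT0 : 0 ≤ Real.log T := Real.log_nonneg (by linarith)
  set F := (weilZeroIndex_finite T).toFinset with hF
  set L := Real.log X with hL
  set S := ∑ ρ ∈ F, (riemannZetaZeroOrder ρ : ℝ) * X ^ (2 * ρ.re) with hS
  have hS0 : 0 ≤ S := Finset.sum_nonneg fun ρ h ↦
    mul_nonneg (order_nonneg_of_mem_WT h) (Real.rpow_nonneg hX0.le _)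
  -- coefficients and the zero sum
  set a : ℂ → ℂ := fun ρ ↦ (riemannZetaZeroOrder ρ : ℂ) * (((((1 + δ : ℝ)) : ℂ) ^ ρ - 1) / ρ) with ha
  have hFre : ∀ ρ ∈ F, 0 < ρ.re ∧ ρ.re ≤ 1 := fun ρ h ↦ ⟨(mem_WT h).2.2.1, (mem_WT h).2.2.2.le⟩
  have ha_le : ∀ ρ ∈ F, ‖a ρ‖ ≤ (riemannZetaZeroOrder ρ : ℝ) * δ := by
    intro ρ hρ
    have hm := order_nonneg_of_mem_WT hρ
    simp only [ha]
    rw [norm_mul, Complex.norm_intCast, abs_of_nonneg (by exact_mod_cast hm)]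
    exact mul_le_mul_of_nonneg_left (norm_shiftCoeff_le hδ0 (hFre ρ hρ).1 (hFre ρ hρ).2) hm
  set Z : ℝ → ℂ := fun x ↦ ∑ ρ ∈ F, a ρ * (x : ℂ) ^ ρ with hZ
  -- the remainder constant
  set R : ℝ := 2 * (M * (Real.log (6 * X) + 6 * X / T * Real.log (6 * X * T) ^ 2)) with hR
  have hRsq : R ^ 2 ≤ 32 * M ^ 2 * L ^ 2 + 23328 * M ^ 2 * X ^ 2 * L ^ 4 / T ^ 2 :=
    remainder_sq_le hM0 hX hT hTX
  -- (a) pointwise bound on [X, 3X]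
  have hpt : ∀ x ∈ Icc X (3 * X), (ψ (x + δ * x) - ψ x - δ * x) ^ 2 ≤ 2 * ‖Z x‖ ^ 2 + 2 * R ^ 2 := by
    intro x hx
    have h := abs_psi_shift_sub_le hM0 hM (by linarith : (2 : ℝ) ≤ X) hδ0 hδ1 hT hx
    have hZx : ∑ ρ ∈ (weilZeroIndex_finite T).toFinset,
        (riemannZetaZeroOrder ρ : ℂ) * (((((1 + δ : ℝ)) : ℂ) ^ ρ - 1) / ρ) * (x : ℂ) ^ ρ = Z x := by
      simp only [hZ, ha, hF]
    rw [hZx] at h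
    have hsq : (ψ (x + δ * x) - ψ x - δ * x) ^ 2 ≤ (‖Z x‖ + R) ^ 2 := by
      rw [← sq_abs (ψ (x + δ * x) - ψ x - δ * x)]
      exact pow_le_pow_left₀ (abs_nonneg _) h 2
    nlinarith [sq_nonneg (‖Z x‖ - R)]
  -- (b) integrate the majorant
  have hZc : Continuous Z := by
    simp only [hZ]
    refine continuous_finsetSum F fun ρ hρ ↦ ?_
    exact continuous_const.mul (Complex.continuous_ofReal_cpow_const (hFre ρ hρ).1)
  have hZn : Continuous fun x : ℝ ↦ ‖Z x‖ ^ 2 := hZc.norm.pow 2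
  have hgc : Continuous fun x : ℝ ↦ 2 * ‖Z x‖ ^ 2 + 2 * R ^ 2 := (hZn.const_mul 2).add continuous_const
  have hI1 : ∫ x in X..(3 * X), (ψ (x + δ * x) - ψ x - δ * x) ^ 2 ≤
      ∫ x in X..(3 * X), (2 * ‖Z x‖ ^ 2 + 2 * R ^ 2) :=
    intervalIntegral.integral_mono_on hX3 (intervalIntegrable_sq_psiShift hX0.le hX3 hδ0)
      (hgc.intervalIntegrable _ _) hpt
  have hI2 : ∫ x in X..(3 * X), (2 * ‖Z x‖ ^ 2 + 2 * R ^ 2) =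
      2 * (∫ x in X..(3 * X), ‖Z x‖ ^ 2) + 4 * R ^ 2 * X := by
    have hc1 : IntervalIntegrable (fun x : ℝ ↦ 2 * ‖Z x‖ ^ 2) volume X (3 * X) :=
      (hZn.const_mul 2).intervalIntegrable _ _
    have hc2 : IntervalIntegrable (fun _ : ℝ ↦ 2 * R ^ 2) volume X (3 * X) := intervalIntegrable_const
    rw [intervalIntegral.integral_add hc1 hc2, intervalIntegral.integral_const_mul,
      intervalIntegral.integral_const, smul_eq_mul]
    ring
  -- (c) the zero-sum integral
  have hI3 : ∫ x in X..(3 * X), ‖Z x‖ ^ 2 ≤ 28 * δ ^ 2 * X * (CK * L ^ 2 * S) :=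
    (integral_normSq_sum_le F a hFre hX0).trans
      (doubleSum_le hCK0 hCK hT hX0 hδ0 hlogTX hlogT0 a ha_le)
  -- (d) combine
  have hmain : ∫ x in X..(3 * X), (ψ (x + δ * x) - ψ x - δ * x) ^ 2 ≤
      56 * CK * (δ ^ 2 * X * L ^ 2 * S) + 128 * M ^ 2 * (X * L ^ 2) +
        93312 * M ^ 2 * (X ^ 3 * L ^ 4 / T ^ 2) := by
    have h4 : 4 * R ^ 2 * X ≤ 4 * (32 * M ^ 2 * L ^ 2 + 23328 * M ^ 2 * X ^ 2 * L ^ 4 / T ^ 2) * X :=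
      mul_le_mul_of_nonneg_right (mul_le_mul_of_nonneg_left hRsq (by norm_num)) hX0.le
    have e : 2 * (28 * δ ^ 2 * X * (CK * L ^ 2 * S)) +
        4 * (32 * M ^ 2 * L ^ 2 + 23328 * M ^ 2 * X ^ 2 * L ^ 4 / T ^ 2) * X =
        56 * CK * (δ ^ 2 * X * L ^ 2 * S) + 128 * M ^ 2 * (X * L ^ 2) +
          93312 * M ^ 2 * (X ^ 3 * L ^ 4 / T ^ 2) := by
      field_simp
      ring
    calc ∫ x in X..(3 * X), (ψ (x + δ * x) - ψ x - δ * x) ^ 2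
        ≤ 2 * (∫ x in X..(3 * X), ‖Z x‖ ^ 2) + 4 * R ^ 2 * X := by rw [← hI2]; exact hI1
      _ ≤ 2 * (28 * δ ^ 2 * X * (CK * L ^ 2 * S)) +
          4 * (32 * M ^ 2 * L ^ 2 + 23328 * M ^ 2 * X ^ 2 * L ^ 4 / T ^ 2) * X := by
          linarith [mul_le_mul_of_nonneg_left hI3 (by norm_num : (0 : ℝ) ≤ 2)]
      _ = _ := e
  have h1 : 0 ≤ δ ^ 2 * X * L ^ 2 * S := by positivity
  have h2 : 0 ≤ X * L ^ 2 := by positivity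
  have h3 : 0 ≤ X ^ 3 * L ^ 4 / T ^ 2 := by positivity
  have hc1 : 56 * CK ≤ 56 * CK + 93440 * M ^ 2 + 1 := by nlinarith [sq_nonneg M]
  have hc2 : 128 * M ^ 2 ≤ 56 * CK + 93440 * M ^ 2 + 1 := by nlinarith [sq_nonneg M]
  have hc3 : 93312 * M ^ 2 ≤ 56 * CK + 93440 * M ^ 2 + 1 := by nlinarith [sq_nonneg M]
  calc ∫ x in X..(3 * X), (ψ (x + δ * x) - ψ x - δ * x) ^ 2
      ≤ 56 * CK * (δ ^ 2 * X * L ^ 2 * S) + 128 * M ^ 2 * (X * L ^ 2) +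
        93312 * M ^ 2 * (X ^ 3 * L ^ 4 / T ^ 2) := hmain
    _ ≤ (56 * CK + 93440 * M ^ 2 + 1) * (δ ^ 2 * X * L ^ 2 * S) +
        (56 * CK + 93440 * M ^ 2 + 1) * (X * L ^ 2) +
        (56 * CK + 93440 * M ^ 2 + 1) * (X ^ 3 * L ^ 4 / T ^ 2) := by
        gcongr
    _ = (56 * CK + 93440 * M ^ 2 + 1) * (δ ^ 2 * X * L ^ 2 * S + X * L ^ 2 + X ^ 3 * L ^ 4 / T ^ 2) := by
        ring

/-! ### §9 The zero-free region: all zeros with `|γ| ≤ X` have `β ≤ 1 − K(log X)^{-3/4}` eventually -/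

/-- `(log log X)^{1/3} ≤ a (log X)^{1/12}` for all large `X` (any `a > 0`). [folklore] -/
private theorem eventually_loglog_rpow_le {a : ℝ} (ha : 0 < a) :
    ∀ᶠ X : ℝ in Filter.atTop,
      Real.log (Real.log X) ^ (1 / 3 : ℝ) ≤ a * Real.log X ^ (1 / 12 : ℝ) := by
  have h1 : ∀ᶠ y : ℝ in Filter.atTop, Real.log y ≤ a ^ 3 * y ^ (1 / 4 : ℝ) := by
    have h := (isLittleO_log_rpow_atTop (by norm_num : (0 : ℝ) < 1 / 4)).bound
      (by positivity : (0 : ℝ) < a ^ 3)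
    filter_upwards [h, Filter.eventually_ge_atTop (0 : ℝ)] with y hy hy0
    rw [Real.norm_eq_abs, Real.norm_eq_abs, abs_of_nonneg (Real.rpow_nonneg hy0 _)] at hy
    exact (le_abs_self _).trans hy
  have h2 := Real.tendsto_log_atTop.eventually h1
  filter_upwards [h2, Filter.eventually_ge_atTop (Real.exp (Real.exp 1))] with X hX hXe
  have hX0 : 0 < X := lt_of_lt_of_le (Real.exp_pos _) hXe
  have hlog : Real.exp 1 ≤ Real.log X := by
    rw [Real.le_log_iff_exp_le hX0]; exact hXe
  have hlog0 : 0 ≤ Real.log X := (Real.exp_pos 1).le.trans hlog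
  have hll0 : 0 ≤ Real.log (Real.log X) := Real.log_nonneg (by linarith [Real.add_one_le_exp (1 : ℝ)])
  calc Real.log (Real.log X) ^ (1 / 3 : ℝ)
      ≤ (a ^ 3 * Real.log X ^ (1 / 4 : ℝ)) ^ (1 / 3 : ℝ) := Real.rpow_le_rpow hll0 hX (by norm_num)
    _ = a * Real.log X ^ (1 / 12 : ℝ) := by
        rw [Real.mul_rpow (by positivity) (Real.rpow_nonneg hlog0 _), ← Real.rpow_mul hlog0,
          show (a ^ 3) = a ^ (3 : ℝ) by norm_num, ← Real.rpow_mul ha.le]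
        norm_num

/-- **Zeros up to height `X` are eventually `K(log X)^{−3/4}`-far from `Re s = 1`**, for every `K`,
given a Vinogradov–Korobov zero-free region `σ ≥ 1 − c/((log|t|)^{2/3}(log log|t|)^{1/3})`,
`|t| ≥ 21` (GM §13.2: "Using … the Vinogradov–Korobov zero-free bound `N(σ,T) = 0` for
`σ ≥ 1 − c(log T)^{−2/3}(log log T)^{−1/3}`"; the finitely many zeros with `|γ| < 21` have `β < 1`
by `riemannZeta_ne_zero_of_one_le_re`). [cite: GuthMaynard2026, §13.2, proof of Corollary 1.3, arXiv p0029:L3–L28] -/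
theorem eventually_re_le_of_zeroFree {c : ℝ} (hc : 0 < c)
    (hVK : ∀ s : ℂ, 21 ≤ |s.im| →
      1 - c / (Real.log |s.im| ^ (2 / 3 : ℝ) * Real.log (Real.log |s.im|) ^ (1 / 3 : ℝ)) ≤ s.re →
        riemannZeta s ≠ 0)
    {K : ℝ} (hK : 0 < K) :
    ∀ᶠ X : ℝ in Filter.atTop, ∀ ρ ∈ (weilZeroIndex_finite X).toFinset,
      ρ.re ≤ 1 - K / Real.log X ^ (3 / 4 : ℝ) := by
  -- (i) the low zeros
  obtain ⟨c₀, hc₀, hlow⟩ : ∃ c₀ : ℝ, 0 < c₀ ∧ ∀ ρ ∈ (weilZeroIndex_finite 21).toFinset, ρ.re ≤ 1 - c₀ := by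
    set F := (weilZeroIndex_finite 21).toFinset with hF
    rcases F.eq_empty_or_nonempty with h | h
    · exact ⟨1, one_pos, fun ρ hρ ↦ by rw [h] at hρ; simp at hρ⟩
    · obtain ⟨ρ₀, hρ₀, hmax⟩ := F.exists_max_image (fun ρ ↦ ρ.re) h
      refine ⟨1 - ρ₀.re, by linarith [(mem_WT hρ₀).2.2.2], fun ρ hρ ↦ ?_⟩
      have := hmax ρ hρ
      linarith
  -- (ii) the eventual inequalities
  have hE1 : ∀ᶠ X : ℝ in Filter.atTop, K / Real.log X ^ (3 / 4 : ℝ) ≤ c₀ := by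
    have ht := (tendsto_rpow_atTop (by norm_num : (0 : ℝ) < 3 / 4)).comp Real.tendsto_log_atTop
    filter_upwards [ht.eventually_ge_atTop (K / c₀)] with X hX'
    have hX : K / c₀ ≤ Real.log X ^ (3 / 4 : ℝ) := hX'
    have hpos : 0 < Real.log X ^ (3 / 4 : ℝ) := lt_of_lt_of_le (by positivity) hX
    rw [div_le_iff₀ hpos]
    have := (div_le_iff₀ hc₀).1 hX
    linarith
  have hE2 := eventually_loglog_rpow_le (div_pos hc hK)
  filter_upwards [hE1, hE2, Filter.eventually_ge_atTop (21 : ℝ)] with X h1 h2 hX21 ρ hρ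
  have hm := mem_WT hρ
  have hX0 : 0 < X := by linarith
  have hlogX : 1 < Real.log X := by
    rw [Real.lt_log_iff_exp_lt hX0]
    have := Real.exp_one_lt_d9; linarith
  have hlogX0 : 0 < Real.log X := by linarith
  have hllX : 0 < Real.log (Real.log X) := Real.log_pos hlogX
  rcases lt_or_ge |ρ.im| 21 with hγ | hγ
  · -- low zero
    have hmem : ρ ∈ (weilZeroIndex_finite 21).toFinset := by
      rw [Set.Finite.mem_toFinset, weilZeroIndex_eq_inter]
      exact ⟨hm.1, hγ.le⟩
    linarith [hlow ρ hmem]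
  · -- high zero: VK
    set u := |ρ.im| with hu
    have hu0 : 0 < u := by linarith
    have huX : u ≤ X := hm.2.1
    have hlogu : 1 < Real.log u := by
      rw [Real.lt_log_iff_exp_lt hu0]
      have := Real.exp_one_lt_d9; linarith
    have hlogu0 : 0 < Real.log u := by linarith
    have hllu : 0 < Real.log (Real.log u) := Real.log_pos hlogu
    set Lu := Real.log u ^ (2 / 3 : ℝ) * Real.log (Real.log u) ^ (1 / 3 : ℝ) with hLu
    set LX := Real.log X ^ (2 / 3 : ℝ) * Real.log (Real.log X) ^ (1 / 3 : ℝ) with hLX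
    have hLu0 : 0 < Lu := by positivity
    have hLX0 : 0 < LX := by positivity
    -- β < 1 - c/Lu
    have hβ : ρ.re < 1 - c / Lu := by
      by_contra hcon
      push Not at hcon
      exact hVK ρ hγ hcon (ZetaZeros.riemannZetaNontrivialZeros.zeta_eq_zero hm.1)
    -- Lu ≤ LX
    have hLuX : Lu ≤ LX := by
      have hl1 : Real.log u ≤ Real.log X := Real.log_le_log hu0 huX
      have hl2 : Real.log (Real.log u) ≤ Real.log (Real.log X) := Real.log_le_log hlogu0 hl1
      rw [hLu, hLX]
      gcongr
    have hcL : c / LX ≤ c / Lu := div_le_div_of_nonneg_left hc.le hLu0 hLuX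
    -- K/(log X)^{3/4} ≤ c/LX
    have hKL : K / Real.log X ^ (3 / 4 : ℝ) ≤ c / LX := by
      rw [div_le_div_iff₀ (by positivity) hLX0, hLX]
      have e : Real.log X ^ (3 / 4 : ℝ) = Real.log X ^ (2 / 3 : ℝ) * Real.log X ^ (1 / 12 : ℝ) := by
        rw [← Real.rpow_add hlogX0]; norm_num
      rw [e]
      have h2' : K * Real.log (Real.log X) ^ (1 / 3 : ℝ) ≤ c * Real.log X ^ (1 / 12 : ℝ) := by
        have := mul_le_mul_of_nonneg_left h2 hK.le
        rw [show K * (c / K * Real.log X ^ (1 / 12 : ℝ)) = c * Real.log X ^ (1 / 12 : ℝ) by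
          field_simp] at this
        exact this
      have h23 : 0 ≤ Real.log X ^ (2 / 3 : ℝ) := Real.rpow_nonneg hlogX0.le _
      calc K * (Real.log X ^ (2 / 3 : ℝ) * Real.log (Real.log X) ^ (1 / 3 : ℝ))
          = Real.log X ^ (2 / 3 : ℝ) * (K * Real.log (Real.log X) ^ (1 / 3 : ℝ)) := by ring
        _ ≤ Real.log X ^ (2 / 3 : ℝ) * (c * Real.log X ^ (1 / 12 : ℝ)) :=
            mul_le_mul_of_nonneg_left h2' h23
        _ = c * (Real.log X ^ (2 / 3 : ℝ) * Real.log X ^ (1 / 12 : ℝ)) := by ring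
    linarith

/-! ### §10 Growth lemmas in the scale `exp(c (log X)^{1/4})` -/

/-- `(log X)^p · exp(−a (log X)^{1/4}) ≤ c` for all large `X` (`a, c > 0`). [folklore] -/
private theorem eventually_log_rpow_mul_exp_neg_le (p : ℝ) {a c : ℝ} (ha : 0 < a) (hc : 0 < c) :
    ∀ᶠ X : ℝ in Filter.atTop,
      Real.log X ^ p * Real.exp (-a * Real.log X ^ (1 / 4 : ℝ)) ≤ c := by
  have ht : Filter.Tendsto (fun X : ℝ ↦ Real.log X ^ (1 / 4 : ℝ)) Filter.atTop Filter.atTop :=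
    (tendsto_rpow_atTop (by norm_num)).comp Real.tendsto_log_atTop
  have hg := tendsto_rpow_mul_exp_neg_mul_atTop_nhds_zero (4 * p) a ha
  have h := (hg.comp ht).eventually (gt_mem_nhds hc)
  filter_upwards [h, Filter.eventually_ge_atTop (1 : ℝ)] with X hX hX1
  have hL : 0 ≤ Real.log X := Real.log_nonneg hX1
  have e : (Real.log X ^ (1 / 4 : ℝ)) ^ (4 * p) = Real.log X ^ p := by
    rw [← Real.rpow_mul hL]; congr 1; ring
  have hX' : (Real.log X ^ (1 / 4 : ℝ)) ^ (4 * p) * Real.exp (-a * Real.log X ^ (1 / 4 : ℝ)) < c := hX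
  rw [e] at hX'
  exact hX'.le

/-- `(log X)^p · exp(a (log X)^{1/4}) ≤ c X^κ` for all large `X` (`κ, c > 0`). [folklore] -/
private theorem eventually_log_rpow_mul_exp_le_rpow (p a : ℝ) {κ c : ℝ} (hκ : 0 < κ) (hc : 0 < c) :
    ∀ᶠ X : ℝ in Filter.atTop,
      Real.log X ^ p * Real.exp (a * Real.log X ^ (1 / 4 : ℝ)) ≤ c * X ^ κ := by
  have h1 := eventually_log_rpow_mul_exp_neg_le p one_pos hc
  have ht : Filter.Tendsto (fun X : ℝ ↦ Real.log X ^ (1 / 4 : ℝ)) Filter.atTop Filter.atTop :=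
    (tendsto_rpow_atTop (by norm_num)).comp Real.tendsto_log_atTop
  filter_upwards [h1, ht.eventually_ge_atTop ((|a| + 1) / κ), ht.eventually_ge_atTop 1,
    Filter.eventually_ge_atTop (1 : ℝ)] with X hX ht3' ht1' hX1
  have ht3 : (|a| + 1) / κ ≤ Real.log X ^ (1 / 4 : ℝ) := ht3'
  have ht1 : 1 ≤ Real.log X ^ (1 / 4 : ℝ) := ht1'
  set t := Real.log X ^ (1 / 4 : ℝ) with ht
  have hX0 : 0 < X := by linarith
  have hL0 : 0 ≤ Real.log X := Real.log_nonneg hX1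
  have hL : Real.log X = t ^ 4 := by
    rw [ht, ← Real.rpow_natCast, ← Real.rpow_mul hL0]; norm_num
  have hXκ : X ^ κ = Real.exp (κ * t ^ 4) := by
    rw [Real.rpow_def_of_pos hX0, hL, mul_comm]
  have hkey : a * t + t ≤ κ * t ^ 4 := by
    have h3 : |a| + 1 ≤ κ * t := by rw [div_le_iff₀ hκ] at ht3; linarith
    have h4 : (|a| + 1) * t ≤ κ * t * t := mul_le_mul_of_nonneg_right h3 (by linarith)
    have h5 : t * t ≤ t ^ 4 := by
      have htt : 1 ≤ t * t := by nlinarith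
      have e4 : t ^ 4 = (t * t) * (t * t) := by ring
      rw [e4]; nlinarith
    have h6 : a * t ≤ |a| * t := mul_le_mul_of_nonneg_right (le_abs_self a) (by linarith)
    nlinarith
  have hsplit : Real.exp (a * t) = Real.exp (-1 * t) * Real.exp (a * t + t) := by
    rw [← Real.exp_add]; ring_nf
  calc Real.log X ^ p * Real.exp (a * t)
      = Real.log X ^ p * Real.exp (-1 * t) * Real.exp (a * t + t) := by rw [hsplit]; ring
    _ ≤ c * Real.exp (κ * t ^ 4) :=
        mul_le_mul hX (Real.exp_le_exp.2 hkey) (Real.exp_pos _).le hc.le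
    _ = c * X ^ κ := by rw [hXκ]

/-! ### §11 The three ranges of `σ` -/

/-- `(log T)^B ≤ (log X)^{max B 0}` for `1 ≤ log T ≤ log X`. [folklore] -/
private theorem log_rpow_le_max {T X B : ℝ} (h1 : 1 ≤ Real.log T) (h2 : Real.log T ≤ Real.log X) :
    Real.log T ^ B ≤ Real.log X ^ max B 0 := by
  have hT0 : 0 ≤ Real.log T := by linarith
  rcases le_or_gt 0 B with hB | hB
  · rw [max_eq_left hB]
    exact Real.rpow_le_rpow hT0 h2 hB
  · rw [max_eq_right hB.le, Real.rpow_zero]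
    exact Real.rpow_le_one_of_one_le_of_nonpos h1 hB.le

/-- Exponent bookkeeping: `(13/15 − ε/2)(30/13 + ε) ≤ 2 − ε/4` for `ε ≥ 0`. [folklore] -/
private theorem exponent_le {ε : ℝ} (hε : 0 ≤ ε) : (13 / 15 - ε / 2) * (30 / 13 + ε) ≤ 2 - ε / 4 := by
  nlinarith

/-- **One bin of the `σ`-decomposition** (the three ranges of GM §13.2: `σ < 1/2` by the trivial
count, `1/2 ≤ σ ≤ 1 − K(log X)^{−3/4}` by the combined density bound, and no zeros beyond): under
the listed hypotheses on `X`, `T` and the zeros, for `σ < 1`,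
`X^{2σ} Σ_{ρ ∈ W_T, Re ρ ≥ σ} m(ρ) ≤ 2 C_d X² (log X)^{max(B,0)} exp(−(A₁+1)(log X)^{1/4})`.
[cite: GuthMaynard2026, §13.2, proof of Corollary 1.4, arXiv p0029:L30–L62] -/
theorem binTerm_le {X T ε Cd B CN K A₁ σ : ℝ} (hX : 1 ≤ X) (hε : 0 < ε) (hCd : 0 < Cd)
    (hCN : 0 < CN) (hA₁ : 0 ≤ A₁) (hK : K = 4 * (A₁ + 1) / ε)
    (hT3 : 3 ≤ T) (hTX : T ≤ X ^ (13 / 15 - ε / 2)) (hlogT : Real.log T ≤ Real.log X)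
    (hlogT1 : 1 ≤ Real.log T)
    (hdens : ∀ σ : ℝ, 1 / 2 ≤ σ → σ ≤ 1 →
      (zetaZeroCountRe σ T : ℝ) ≤ Cd * T ^ ((30 / 13 + ε) * (1 - σ)) * Real.log T ^ B)
    (htot : ∑ ρ ∈ (weilZeroIndex_finite T).toFinset, (riemannZetaZeroOrder ρ : ℝ) ≤
      CN * T * Real.log T)
    (hzf : ∀ ρ ∈ (weilZeroIndex_finite T).toFinset, ρ.re ≤ 1 - K / Real.log X ^ (3 / 4 : ℝ))
    (hE5 : CN * Real.log X * Real.exp ((A₁ + 1) * Real.log X ^ (1 / 4 : ℝ)) ≤ Cd * X ^ (2 / 15 : ℝ))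
    (hσ1 : σ < 1) :
    X ^ (2 * σ) * ∑ ρ ∈ (weilZeroIndex_finite T).toFinset with σ ≤ ρ.re, (riemannZetaZeroOrder ρ : ℝ) ≤
      2 * Cd * X ^ 2 * Real.log X ^ max B 0 * Real.exp (-(A₁ + 1) * Real.log X ^ (1 / 4 : ℝ)) := by
  classical
  set F := (weilZeroIndex_finite T).toFinset with hF
  set L := Real.log X with hL
  set t := Real.log X ^ (1 / 4 : ℝ) with ht
  set M := ∑ ρ ∈ F with σ ≤ ρ.re, (riemannZetaZeroOrder ρ : ℝ) with hM
  have hX0 : 0 < X := by linarith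
  have hT0 : 0 < T := by linarith
  have hL1 : 1 ≤ L := hlogT1.trans hlogT
  have hL0 : 0 < L := by linarith
  have ht0 : 0 < t := Real.rpow_pos_of_pos hL0 _
  have hLt : L = t ^ 4 := by
    rw [ht, ← Real.rpow_natCast, ← Real.rpow_mul hL0.le]; norm_num
  have hL34 : L ^ (3 / 4 : ℝ) = t ^ 3 := by
    rw [ht, ← Real.rpow_natCast, ← Real.rpow_mul hL0.le]; norm_num
  have hLB : 1 ≤ L ^ max B 0 := Real.one_le_rpow hL1 (le_max_right _ _)
  have hM0 : 0 ≤ M := Finset.sum_nonneg fun ρ h ↦ order_nonneg_of_mem_WT (Finset.mem_filter.1 h).1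
  have hG0 : 0 ≤ 2 * Cd * X ^ 2 * L ^ max B 0 * Real.exp (-(A₁ + 1) * t) := by positivity
  -- empty bin
  by_cases hemp : (F.filter fun ρ ↦ σ ≤ ρ.re) = ∅
  · have : M = 0 := by rw [hM, hemp, Finset.sum_empty]
    rw [this, mul_zero]; exact hG0
  -- a zero in the bin forces `1 - σ ≥ K/t³`
  obtain ⟨ρ₀, hρ₀⟩ := Finset.nonempty_iff_ne_empty.2 hemp
  rw [Finset.mem_filter] at hρ₀
  have hgap : K / t ^ 3 ≤ 1 - σ := by
    have := hzf ρ₀ hρ₀.1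
    rw [hL34] at this
    linarith [hρ₀.2]
  have hKpos : 0 < K := by rw [hK]; positivity
  -- the saving `X^{-(ε/4)(1-σ)} ≤ exp(-(A₁+1) t)`
  have hsave : X ^ (-(ε / 4) * (1 - σ)) ≤ Real.exp (-(A₁ + 1) * t) := by
    have h1 : X ^ (-(ε / 4) * (1 - σ)) ≤ X ^ (-(ε / 4) * (K / t ^ 3)) := by
      refine Real.rpow_le_rpow_of_exponent_le hX ?_
      nlinarith
    have h2 : X ^ (-(ε / 4) * (K / t ^ 3)) = Real.exp (-(A₁ + 1) * t) := by
      rw [Real.rpow_def_of_pos hX0, ← hL, hLt, hK]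
      congr 1
      field_simp
    exact h1.trans h2.le
  rcases lt_or_ge σ (1 / 2) with hσ | hσ
  · -- σ < 1/2: trivial count
    have hX2σ : X ^ (2 * σ) ≤ X := by
      calc X ^ (2 * σ) ≤ X ^ (1 : ℝ) := Real.rpow_le_rpow_of_exponent_le hX (by linarith)
        _ = X := Real.rpow_one X
    have hMtot : M ≤ CN * T * Real.log T := by
      refine le_trans ?_ htot
      exact Finset.sum_le_sum_of_subset_of_nonneg (Finset.filter_subset _ _)
        fun ρ h _ ↦ order_nonneg_of_mem_WT h
    have hT1315 : T ≤ X ^ (13 / 15 : ℝ) :=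
      hTX.trans (Real.rpow_le_rpow_of_exponent_le hX (by linarith))
    have hM1 : M ≤ CN * X ^ (13 / 15 : ℝ) * L := by
      calc M ≤ CN * T * Real.log T := hMtot
        _ ≤ CN * X ^ (13 / 15 : ℝ) * L := by gcongr
    -- CN L ≤ Cd X^{2/15} e^{-(A₁+1)t}
    have hE5' : CN * L ≤ Cd * X ^ (2 / 15 : ℝ) * Real.exp (-(A₁ + 1) * t) := by
      have hexp : Real.exp ((A₁ + 1) * t) * Real.exp (-(A₁ + 1) * t) = 1 := by
        rw [← Real.exp_add, show (A₁ + 1) * t + -(A₁ + 1) * t = 0 by ring, Real.exp_zero]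
      calc CN * L = CN * L * Real.exp ((A₁ + 1) * t) * Real.exp (-(A₁ + 1) * t) := by
            rw [mul_assoc (CN * L), hexp, mul_one]
        _ ≤ Cd * X ^ (2 / 15 : ℝ) * Real.exp (-(A₁ + 1) * t) :=
            mul_le_mul_of_nonneg_right hE5 (Real.exp_pos _).le
    have hXpow : X * X ^ (13 / 15 : ℝ) * X ^ (2 / 15 : ℝ) = X ^ 2 := by
      rw [mul_assoc, ← Real.rpow_add hX0]; norm_num; ring
    calc X ^ (2 * σ) * M ≤ X * (CN * X ^ (13 / 15 : ℝ) * L) :=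
          mul_le_mul hX2σ hM1 hM0 hX0.le
      _ = X * X ^ (13 / 15 : ℝ) * (CN * L) := by ring
      _ ≤ X * X ^ (13 / 15 : ℝ) * (Cd * X ^ (2 / 15 : ℝ) * Real.exp (-(A₁ + 1) * t)) :=
          mul_le_mul_of_nonneg_left hE5' (by positivity)
      _ = Cd * X ^ 2 * Real.exp (-(A₁ + 1) * t) := by rw [← hXpow]; ring
      _ ≤ 2 * Cd * X ^ 2 * L ^ max B 0 * Real.exp (-(A₁ + 1) * t) := by
          have : Cd * X ^ 2 * Real.exp (-(A₁ + 1) * t) ≤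
              Cd * X ^ 2 * Real.exp (-(A₁ + 1) * t) * (2 * L ^ max B 0) :=
            le_mul_of_one_le_right (by positivity) (by linarith)
          linarith
  · -- 1/2 ≤ σ < 1: the combined density bound
    have hM2 : M ≤ 2 * (Cd * T ^ ((30 / 13 + ε) * (1 - σ)) * Real.log T ^ B) :=
      (sum_order_filter_le_two_mul_count σ T).trans
        (mul_le_mul_of_nonneg_left (hdens σ hσ hσ1.le) (by norm_num))
    have hlogB : Real.log T ^ B ≤ L ^ max B 0 := log_rpow_le_max hlogT1 hlogT
    have h1σ : 0 ≤ 1 - σ := by linarith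
    have hTpow : T ^ ((30 / 13 + ε) * (1 - σ)) ≤ X ^ (2 * (1 - σ)) * X ^ (-(ε / 4) * (1 - σ)) := by
      calc T ^ ((30 / 13 + ε) * (1 - σ))
          ≤ (X ^ (13 / 15 - ε / 2)) ^ ((30 / 13 + ε) * (1 - σ)) :=
            Real.rpow_le_rpow hT0.le hTX (by positivity)
        _ = X ^ ((13 / 15 - ε / 2) * (30 / 13 + ε) * (1 - σ)) := by
            rw [← Real.rpow_mul hX0.le]; ring_nf
        _ ≤ X ^ ((2 - ε / 4) * (1 - σ)) :=
            Real.rpow_le_rpow_of_exponent_le hX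
              (mul_le_mul_of_nonneg_right (exponent_le hε.le) h1σ)
        _ = X ^ (2 * (1 - σ)) * X ^ (-(ε / 4) * (1 - σ)) := by
            rw [← Real.rpow_add hX0]; ring_nf
    have hX2 : X ^ (2 * σ) * X ^ (2 * (1 - σ)) = X ^ 2 := by
      rw [← Real.rpow_add hX0, show 2 * σ + 2 * (1 - σ) = (2 : ℝ) by ring, Real.rpow_two]
    have hlogT0 : 0 ≤ Real.log T ^ B := Real.rpow_nonneg (by linarith) _
    calc X ^ (2 * σ) * M
        ≤ X ^ (2 * σ) * (2 * (Cd * T ^ ((30 / 13 + ε) * (1 - σ)) * Real.log T ^ B)) :=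
          mul_le_mul_of_nonneg_left hM2 (Real.rpow_nonneg hX0.le _)
      _ ≤ X ^ (2 * σ) * (2 * (Cd * (X ^ (2 * (1 - σ)) * X ^ (-(ε / 4) * (1 - σ))) * L ^ max B 0)) := by
          gcongr
      _ = 2 * Cd * (X ^ (2 * σ) * X ^ (2 * (1 - σ))) * L ^ max B 0 * X ^ (-(ε / 4) * (1 - σ)) := by
          ring
      _ ≤ 2 * Cd * (X ^ (2 * σ) * X ^ (2 * (1 - σ))) * L ^ max B 0 * Real.exp (-(A₁ + 1) * t) :=
          mul_le_mul_of_nonneg_left hsave (by positivity)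
      _ = 2 * Cd * X ^ 2 * L ^ max B 0 * Real.exp (-(A₁ + 1) * t) := by rw [hX2]

/-! ### §12 Assembly: the mean square from the combined density bound and the zero-free region -/

/-- The parameter `T = δ⁻¹ exp((A₁+1)(log X)^{1/4})` of GM §13.2 and its range. [cite: GuthMaynard2026, §13.2, proof of Corollary 1.4, arXiv p0029:L30–L62] -/
theorem T_bounds {X δ ε A₁ T₀ T : ℝ} (hX : 21 ≤ X) (hε : 0 < ε) (hA₁ : 0 ≤ A₁)
    (hδlo : X ^ (-(13 / 15 : ℝ) + ε) ≤ δ) (hδhi : δ ≤ X ^ (-(1 / 100 : ℝ)))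
    (h1 : max 3 T₀ ≤ X ^ (1 / 100 : ℝ))
    (h2 : Real.exp ((A₁ + 1) * Real.log X ^ (1 / 4 : ℝ)) ≤ X ^ (ε / 2))
    (hT : T = δ⁻¹ * Real.exp ((A₁ + 1) * Real.log X ^ (1 / 4 : ℝ))) :
    0 < δ ∧ δ ≤ 1 ∧ 3 ≤ T ∧ T₀ ≤ T ∧ T ≤ X ^ (13 / 15 - ε / 2) ∧ T ≤ X ∧
      Real.log T ≤ Real.log X ∧ 1 ≤ Real.log T := by
  have hX0 : 0 < X := by linarith
  have hX1 : 1 ≤ X := by linarith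
  have hδ0 : 0 < δ := lt_of_lt_of_le (Real.rpow_pos_of_pos hX0 _) hδlo
  have hδ1 : δ ≤ 1 := hδhi.trans (Real.rpow_le_one_of_one_le_of_nonpos hX1 (by norm_num))
  have hexp1 : 1 ≤ Real.exp ((A₁ + 1) * Real.log X ^ (1 / 4 : ℝ)) := by
    rw [Real.one_le_exp_iff]
    exact mul_nonneg (by linarith) (Real.rpow_nonneg (Real.log_nonneg hX1) _)
  -- lower bound
  have hinv_lo : X ^ (1 / 100 : ℝ) ≤ δ⁻¹ := by
    have : (X ^ (-(1 / 100 : ℝ)))⁻¹ ≤ δ⁻¹ := by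
      rw [inv_le_inv₀ (Real.rpow_pos_of_pos hX0 _) hδ0]; exact hδhi
    rwa [Real.rpow_neg hX0.le, inv_inv] at this
  have hTlo : X ^ (1 / 100 : ℝ) ≤ T := by
    rw [hT]
    calc X ^ (1 / 100 : ℝ) = X ^ (1 / 100 : ℝ) * 1 := (mul_one _).symm
      _ ≤ δ⁻¹ * Real.exp ((A₁ + 1) * Real.log X ^ (1 / 4 : ℝ)) :=
          mul_le_mul hinv_lo hexp1 zero_le_one (inv_pos.2 hδ0).le
  have h3 : 3 ≤ T := ((le_max_left _ _).trans h1).trans hTlo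
  have hT₀ : T₀ ≤ T := ((le_max_right _ _).trans h1).trans hTlo
  -- upper bound
  have hinv_hi : δ⁻¹ ≤ X ^ (13 / 15 - ε) := by
    have : δ⁻¹ ≤ (X ^ (-(13 / 15 : ℝ) + ε))⁻¹ := by
      rw [inv_le_inv₀ hδ0 (Real.rpow_pos_of_pos hX0 _)]; exact hδlo
    rw [← Real.rpow_neg hX0.le] at this
    convert this using 2; ring
  have hThi : T ≤ X ^ (13 / 15 - ε / 2) := by
    rw [hT]
    calc δ⁻¹ * Real.exp ((A₁ + 1) * Real.log X ^ (1 / 4 : ℝ))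
        ≤ X ^ (13 / 15 - ε) * X ^ (ε / 2) :=
          mul_le_mul hinv_hi h2 (Real.exp_pos _).le (Real.rpow_nonneg hX0.le _)
      _ = X ^ (13 / 15 - ε / 2) := by rw [← Real.rpow_add hX0]; ring_nf
  have hTX : T ≤ X := hThi.trans (by
    calc X ^ (13 / 15 - ε / 2) ≤ X ^ (1 : ℝ) := Real.rpow_le_rpow_of_exponent_le hX1 (by linarith)
      _ = X := Real.rpow_one X)
  have hT0 : 0 < T := by linarith
  have hlogT : Real.log T ≤ Real.log X := Real.log_le_log hT0 hTX
  have hlogT1 : 1 ≤ Real.log T := by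
    rw [Real.le_log_iff_exp_le hT0]
    have := Real.exp_one_lt_d9; linarith
  exact ⟨hδ0, hδ1, h3, hT₀, hThi, hTX, hlogT, hlogT1⟩

/-- **Summing the bins**: if every bin obeys `X^{2σ} Σ_{Re ρ ≥ σ} m(ρ) ≤ G` (`0 ≤ σ < 1`) then
`Σ_{ρ ∈ W_T} m(ρ) X^{2Re ρ} ≤ e² (log X + 1) G` (`X ≥ 3`). [cite: GuthMaynard2026, §13.2, proof of Corollary 1.3, arXiv p0029:L3–L28] -/
theorem zeroSum_le_of_bins {X T G : ℝ} (hX : 3 ≤ X) (hG : 0 ≤ G)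
    (hbin : ∀ σ : ℝ, 0 ≤ σ → σ < 1 →
      X ^ (2 * σ) * ∑ ρ ∈ (weilZeroIndex_finite T).toFinset with σ ≤ ρ.re,
        (riemannZetaZeroOrder ρ : ℝ) ≤ G) :
    ∑ ρ ∈ (weilZeroIndex_finite T).toFinset, (riemannZetaZeroOrder ρ : ℝ) * X ^ (2 * ρ.re) ≤
      Real.exp 2 * (Real.log X + 1) * G := by
  have hX1 : 1 < X := by linarith
  have hX0 : 0 < X := by linarith
  have hlog0 : 0 < Real.log X := Real.log_pos hX1
  set Lc : ℕ := ⌈Real.log X⌉₊ with hLc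
  have hLc0 : 0 < Lc := Nat.ceil_pos.2 hlog0
  have hLcL : Real.log X ≤ Lc := Nat.le_ceil _
  have hLc1 : (Lc : ℝ) ≤ Real.log X + 1 := (Nat.ceil_lt_add_one hlog0.le).le
  have hLc0' : (0 : ℝ) < Lc := by exact_mod_cast hLc0
  have h := sum_order_mul_rpow_le_bins T hX1 hLc0 hLcL
  refine h.trans ?_
  have hterm : ∀ j ∈ Finset.range Lc, X ^ (2 * (j : ℝ) / Lc) *
      ∑ ρ ∈ (weilZeroIndex_finite T).toFinset with (j : ℝ) / Lc ≤ ρ.re,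
        (riemannZetaZeroOrder ρ : ℝ) ≤ G := by
    intro j hj
    rw [Finset.mem_range] at hj
    have hσ1 : (j : ℝ) / Lc < 1 := by
      rw [div_lt_one hLc0']; exact_mod_cast hj
    have := hbin ((j : ℝ) / Lc) (by positivity) hσ1
    rwa [mul_div_assoc] 
  calc Real.exp 2 * ∑ j ∈ Finset.range Lc, X ^ (2 * (j : ℝ) / Lc) *
        ∑ ρ ∈ (weilZeroIndex_finite T).toFinset with (j : ℝ) / Lc ≤ ρ.re, (riemannZetaZeroOrder ρ : ℝ)
      ≤ Real.exp 2 * ∑ j ∈ Finset.range Lc, G :=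
        mul_le_mul_of_nonneg_left (Finset.sum_le_sum hterm) (Real.exp_pos _).le
    _ = Real.exp 2 * (Lc * G) := by rw [Finset.sum_const, Finset.card_range, nsmul_eq_mul]
    _ ≤ Real.exp 2 * ((Real.log X + 1) * G) := by gcongr
    _ = Real.exp 2 * (Real.log X + 1) * G := by ring

/-- **The three terms of the density-free bound, at `T = δ⁻¹exp((A₁+1)(log X)^{1/4})`** — each is at
most `δ² X³ exp(−A₁ (log X)^{1/4})` once `X` satisfies the listed growth conditions.
[cite: GuthMaynard2026, §13.2, proof of Corollary 1.4, arXiv p0029:L30–L62] -/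
theorem final_step {X δ ε A₁ T₀ C₀ CN Cd B K : ℝ}
    (hX : 21 ≤ X) (hε : 0 < ε) (hA₁ : 1 ≤ A₁) (hC₀ : 0 < C₀) (hCN : 0 < CN) (hCd : 0 < Cd)
    (hK : K = 4 * (A₁ + 1) / ε)
    (hcore : ∀ X : ℝ, 6 ≤ X → ∀ δ : ℝ, 0 ≤ δ → δ ≤ 1 → ∀ T : ℝ, 2 ≤ T → T ≤ X →
      ∫ x in X..(3 * X), (ψ (x + δ * x) - ψ x - δ * x) ^ 2 ≤
        C₀ * (δ ^ 2 * X * Real.log X ^ 2 *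
            ∑ ρ ∈ (weilZeroIndex_finite T).toFinset, (riemannZetaZeroOrder ρ : ℝ) * X ^ (2 * ρ.re)
          + X * Real.log X ^ 2 + X ^ 3 * Real.log X ^ 4 / T ^ 2))
    (htotal : ∀ T : ℝ, 2 ≤ T →
      ∑ ρ ∈ (weilZeroIndex_finite T).toFinset, (riemannZetaZeroOrder ρ : ℝ) ≤ CN * T * Real.log T)
    (hdens : ∀ T : ℝ, T₀ ≤ T → ∀ σ : ℝ, 1 / 2 ≤ σ → σ ≤ 1 →
      (zetaZeroCountRe σ T : ℝ) ≤ Cd * T ^ ((30 / 13 + ε) * (1 - σ)) * Real.log T ^ B)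
    (hδlo : X ^ (-(13 / 15 : ℝ) + ε) ≤ δ) (hδhi : δ ≤ X ^ (-(1 / 100 : ℝ)))
    (h1 : max 3 T₀ ≤ X ^ (1 / 100 : ℝ))
    (h2 : Real.exp ((A₁ + 1) * Real.log X ^ (1 / 4 : ℝ)) ≤ X ^ (ε / 2))
    (h4 : ∀ ρ ∈ (weilZeroIndex_finite X).toFinset, ρ.re ≤ 1 - K / Real.log X ^ (3 / 4 : ℝ))
    (h5 : CN * Real.log X * Real.exp ((A₁ + 1) * Real.log X ^ (1 / 4 : ℝ)) ≤ Cd * X ^ (2 / 15 : ℝ))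
    (h6 : 4 * Real.exp 2 * C₀ * Cd * (Real.log X ^ max B 0 * Real.log X ^ 3) *
      Real.exp (-1 * Real.log X ^ (1 / 4 : ℝ)) ≤ 1)
    (h7 : C₀ * Real.log X ^ 2 * Real.exp (A₁ * Real.log X ^ (1 / 4 : ℝ)) ≤ X ^ (4 / 15 : ℝ))
    (h8 : C₀ * Real.log X ^ 4 * Real.exp (-(A₁ + 2) * Real.log X ^ (1 / 4 : ℝ)) ≤ 1) :
    ∫ x in X..(3 * X), (ψ (x + δ * x) - ψ x - δ * x) ^ 2 ≤
      3 * δ ^ 2 * X ^ 3 * Real.exp (-A₁ * Real.log X ^ (1 / 4 : ℝ)) := by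
  set L := Real.log X with hL
  set t := Real.log X ^ (1 / 4 : ℝ) with ht
  set T := δ⁻¹ * Real.exp ((A₁ + 1) * t) with hT
  have hX0 : 0 < X := by linarith
  have hX1 : 1 ≤ X := by linarith
  obtain ⟨hδ0, hδ1, hT3, hT₀T, hThi, hTX, hlogT, hlogT1⟩ :=
    T_bounds (T₀ := T₀) hX hε (by linarith) hδlo hδhi h1 h2 hT
  have hT0 : 0 < T := by linarith
  have hL1 : 1 ≤ L := hlogT1.trans hlogT
  have hL0 : 0 < L := by linarith
  set F := (weilZeroIndex_finite T).toFinset with hF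
  set S := ∑ ρ ∈ F, (riemannZetaZeroOrder ρ : ℝ) * X ^ (2 * ρ.re) with hS
  set G := 2 * Cd * X ^ 2 * L ^ max B 0 * Real.exp (-(A₁ + 1) * t) with hG
  have hG0 : 0 ≤ G := by positivity
  set E := δ ^ 2 * X ^ 3 * Real.exp (-A₁ * t) with hE
  have hE0 : 0 ≤ E := by positivity
  -- the density-free bound
  have hmain := hcore X (by linarith) δ hδ0.le hδ1 T (by linarith) hTX
  -- the zeros of `W_T` lie in `W_X`
  have hzf : ∀ ρ ∈ F, ρ.re ≤ 1 - K / L ^ (3 / 4 : ℝ) := by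
    intro ρ hρ
    have hm := mem_WT hρ
    refine h4 ρ ?_
    rw [Set.Finite.mem_toFinset, weilZeroIndex_eq_inter]
    exact ⟨hm.1, hm.2.1.trans hTX⟩
  -- the bins
  have hbin : ∀ σ : ℝ, 0 ≤ σ → σ < 1 →
      X ^ (2 * σ) * ∑ ρ ∈ F with σ ≤ ρ.re, (riemannZetaZeroOrder ρ : ℝ) ≤ G :=
    fun σ _ hσ1 ↦ binTerm_le hX1 hε hCd hCN (by linarith) hK hT3 hThi hlogT hlogT1 (hdens T hT₀T)
      (htotal T (by linarith)) hzf h5 hσ1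
  have hSle : S ≤ Real.exp 2 * (L + 1) * G := zeroSum_le_of_bins (by linarith) hG0 hbin
  -- exponential identities
  have he1 : Real.exp (-(A₁ + 1) * t) = Real.exp (-A₁ * t) * Real.exp (-1 * t) := by
    rw [← Real.exp_add]; ring_nf
  -- piece 1
  have hp1 : C₀ * (δ ^ 2 * X * L ^ 2 * S) ≤ E := by
    have hL2 : L + 1 ≤ 2 * L := by linarith
    have hS2 : S ≤ Real.exp 2 * (2 * L) * G :=
      hSle.trans (mul_le_mul_of_nonneg_right
        (mul_le_mul_of_nonneg_left hL2 (Real.exp_pos _).le) hG0)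
    calc C₀ * (δ ^ 2 * X * L ^ 2 * S)
        ≤ C₀ * (δ ^ 2 * X * L ^ 2 * (Real.exp 2 * (2 * L) * G)) :=
          mul_le_mul_of_nonneg_left (mul_le_mul_of_nonneg_left hS2 (by positivity)) hC₀.le
      _ = E * (4 * Real.exp 2 * C₀ * Cd * (L ^ max B 0 * L ^ 3) * Real.exp (-1 * t)) := by
          rw [hG, hE, he1]; ring
      _ ≤ E * 1 := mul_le_mul_of_nonneg_left h6 hE0
      _ = E := mul_one E
  -- piece 2
  have hp2 : C₀ * (X * L ^ 2) ≤ E := by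
    have hδ2 : X ^ (4 / 15 : ℝ) ≤ δ ^ 2 * X ^ 2 := by
      have hd : X ^ (-(13 / 15 : ℝ)) ≤ δ :=
        (Real.rpow_le_rpow_of_exponent_le hX1 (by linarith)).trans hδlo
      have hd2 : X ^ (-(13 / 15 : ℝ)) * X ^ (-(13 / 15 : ℝ)) ≤ δ * δ :=
        mul_le_mul hd hd (Real.rpow_nonneg hX0.le _) hδ0.le
      have e : X ^ (4 / 15 : ℝ) = X ^ (-(13 / 15 : ℝ)) * X ^ (-(13 / 15 : ℝ)) * X ^ 2 := by
        rw [← Real.rpow_add hX0, ← Real.rpow_two, ← Real.rpow_add hX0]; norm_num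
      rw [e]; nlinarith [sq_nonneg X]
    have hexp : Real.exp (A₁ * t) * Real.exp (-A₁ * t) = 1 := by
      rw [← Real.exp_add, show A₁ * t + -A₁ * t = 0 by ring, Real.exp_zero]
    calc C₀ * (X * L ^ 2) = C₀ * L ^ 2 * Real.exp (A₁ * t) * (X * Real.exp (-A₁ * t)) := by
          rw [show C₀ * L ^ 2 * Real.exp (A₁ * t) * (X * Real.exp (-A₁ * t)) =
            C₀ * (X * L ^ 2) * (Real.exp (A₁ * t) * Real.exp (-A₁ * t)) by ring, hexp, mul_one]
      _ ≤ X ^ (4 / 15 : ℝ) * (X * Real.exp (-A₁ * t)) :=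
          mul_le_mul_of_nonneg_right h7 (by positivity)
      _ ≤ δ ^ 2 * X ^ 2 * (X * Real.exp (-A₁ * t)) :=
          mul_le_mul_of_nonneg_right hδ2 (by positivity)
      _ = E := by rw [hE]; ring
  -- piece 3
  have hp3 : C₀ * (X ^ 3 * L ^ 4 / T ^ 2) ≤ E := by
    have hTsq : T ^ 2 = δ⁻¹ ^ 2 * Real.exp ((A₁ + 1) * t) ^ 2 := by rw [hT, mul_pow]
    have hexp : Real.exp (-A₁ * t) * Real.exp (-(A₁ + 2) * t) * Real.exp ((A₁ + 1) * t) ^ 2 = 1 := by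
      rw [sq, ← Real.exp_add, ← Real.exp_add, ← Real.exp_add]
      convert Real.exp_zero using 2
      ring
    have e : X ^ 3 * L ^ 4 / T ^ 2 = E * (L ^ 4 * Real.exp (-(A₁ + 2) * t)) := by
      rw [hTsq, hE, div_eq_iff (by positivity)]
      calc X ^ 3 * L ^ 4 = X ^ 3 * L ^ 4 * (δ * δ⁻¹) ^ 2 *
            (Real.exp (-A₁ * t) * Real.exp (-(A₁ + 2) * t) * Real.exp ((A₁ + 1) * t) ^ 2) := by
            rw [hexp, mul_inv_cancel₀ hδ0.ne']; ring
        _ = δ ^ 2 * X ^ 3 * Real.exp (-A₁ * t) * (L ^ 4 * Real.exp (-(A₁ + 2) * t)) *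
            (δ⁻¹ ^ 2 * Real.exp ((A₁ + 1) * t) ^ 2) := by ring
    calc C₀ * (X ^ 3 * L ^ 4 / T ^ 2) = E * (C₀ * L ^ 4 * Real.exp (-(A₁ + 2) * t)) := by
          rw [e]; ring
      _ ≤ E * 1 := mul_le_mul_of_nonneg_left h8 hE0
      _ = E := mul_one E
  -- total
  calc ∫ x in X..(3 * X), (ψ (x + δ * x) - ψ x - δ * x) ^ 2
      ≤ C₀ * (δ ^ 2 * X * L ^ 2 * S + X * L ^ 2 + X ^ 3 * L ^ 4 / T ^ 2) := hmain
    _ = C₀ * (δ ^ 2 * X * L ^ 2 * S) + C₀ * (X * L ^ 2) + C₀ * (X ^ 3 * L ^ 4 / T ^ 2) := by ring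
    _ ≤ E + E + E := add_le_add (add_le_add hp1 hp2) hp3
    _ = 3 * δ ^ 2 * X ^ 3 * Real.exp (-A₁ * t) := by rw [hE]; ring

/-- **Mean square of `ψ` in short intervals from a combined zero-density bound and a
Vinogradov–Korobov zero-free region** (Guth–Maynard, Ann. of Math. 203 (2026), §13, proof of
Cor. 1.4: the target display "`∫_X^{3X} |Σ_{|ρ|<T} x^ρ((1+δ)^ρ−1)/ρ|² dx ≪ δ²X³exp(−3(log X)^{1/4})`"
together with the explicit-formula step): if
`N(σ, T) ≤ C T^{(30/13+η)(1−σ)} (log T)^B` uniformly on `σ ∈ [1/2, 1]`, `T ≥ T₀(η)`, for every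
`η > 0`, and `ζ(s) ≠ 0` for `|Im s| ≥ 21`, `Re s ≥ 1 − c/((log|Im s|)^{2/3}(log log|Im s|)^{1/3})`,
then for every `ε > 0` and every `A` there are `C, X₀` with
`∫_X^{3X} (ψ(x+δx) − ψ(x) − δx)² dx ≤ C δ² X³ exp(−A (log X)^{1/4})` for `X ≥ X₀`,
`X^{−13/15+ε} ≤ δ ≤ X^{−1/100}`. (GM print `A = 3`, `δ = X^{−13/15+ε/2}`; every fixed `A` by taking
`T = δ⁻¹exp((A+1)(log X)^{1/4})`.) [cite: GuthMaynard2026, §13.2, proof of Corollary 1.4, arXiv p0029:L30–L62] -/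
theorem psiMeanSquareShort_of_combined
    (hcomb : ∀ η : ℝ, 0 < η → ∃ C B T₀ : ℝ, 0 < C ∧ ∀ T : ℝ, T₀ ≤ T → ∀ σ : ℝ, 1 / 2 ≤ σ → σ ≤ 1 →
      (zetaZeroCountRe σ T : ℝ) ≤ C * T ^ ((30 / 13 + η) * (1 - σ)) * Real.log T ^ B)
    (hVK : ∃ c : ℝ, 0 < c ∧ ∀ s : ℂ, 21 ≤ |s.im| →
      1 - c / (Real.log |s.im| ^ (2 / 3 : ℝ) * Real.log (Real.log |s.im|) ^ (1 / 3 : ℝ)) ≤ s.re →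
        riemannZeta s ≠ 0)
    (ε : ℝ) (hε : 0 < ε) (A : ℝ) :
    ∃ C X₀ : ℝ, ∀ X : ℝ, X₀ ≤ X → ∀ δ : ℝ,
      X ^ (-(13 / 15 : ℝ) + ε) ≤ δ → δ ≤ X ^ (-(1 / 100 : ℝ)) →
      ∫ x in X..(3 * X), (ψ (x + δ * x) - ψ x - δ * x) ^ 2 ≤
        C * δ ^ 2 * X ^ 3 * Real.exp (-A * Real.log X ^ (1 / 4 : ℝ)) := by
  set A₁ := max A 1 with hA₁
  have hA₁1 : 1 ≤ A₁ := le_max_right _ _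
  have hAA₁ : A ≤ A₁ := le_max_left _ _
  obtain ⟨C₀, hC₀, hcore⟩ := exists_meanSquare_le_zeroSum
  obtain ⟨CN, hCN, htotal⟩ := exists_sum_order_le
  obtain ⟨Cd, B, T₀, hCd, hdens⟩ := hcomb ε hε
  obtain ⟨c, hc, hVK'⟩ := hVK
  set K := 4 * (A₁ + 1) / ε with hK
  have hKpos : 0 < K := by positivity
  -- the growth conditions
  have hE1 : ∀ᶠ X : ℝ in Filter.atTop, max 3 T₀ ≤ X ^ (1 / 100 : ℝ) :=
    (tendsto_rpow_atTop (by norm_num)).eventually_ge_atTop _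
  have hE2 : ∀ᶠ X : ℝ in Filter.atTop,
      Real.log X ^ (0 : ℝ) * Real.exp ((A₁ + 1) * Real.log X ^ (1 / 4 : ℝ)) ≤ 1 * X ^ (ε / 2) :=
    eventually_log_rpow_mul_exp_le_rpow 0 (A₁ + 1) (by positivity) one_pos
  have hE4 := eventually_re_le_of_zeroFree hc hVK' hKpos
  have hE5 : ∀ᶠ X : ℝ in Filter.atTop,
      Real.log X ^ (1 : ℝ) * Real.exp ((A₁ + 1) * Real.log X ^ (1 / 4 : ℝ)) ≤ Cd / CN * X ^ (2 / 15 : ℝ) :=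
    eventually_log_rpow_mul_exp_le_rpow 1 (A₁ + 1) (by norm_num) (div_pos hCd hCN)
  have hE6 : ∀ᶠ X : ℝ in Filter.atTop,
      Real.log X ^ (max B 0 + 3) * Real.exp (-1 * Real.log X ^ (1 / 4 : ℝ)) ≤
        1 / (4 * Real.exp 2 * C₀ * Cd) :=
    eventually_log_rpow_mul_exp_neg_le _ one_pos (by positivity)
  have hE7 : ∀ᶠ X : ℝ in Filter.atTop,
      Real.log X ^ (2 : ℝ) * Real.exp (A₁ * Real.log X ^ (1 / 4 : ℝ)) ≤ 1 / C₀ * X ^ (4 / 15 : ℝ) :=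
    eventually_log_rpow_mul_exp_le_rpow 2 A₁ (by norm_num) (by positivity)
  have hE8 : ∀ᶠ X : ℝ in Filter.atTop,
      Real.log X ^ (4 : ℝ) * Real.exp (-(A₁ + 2) * Real.log X ^ (1 / 4 : ℝ)) ≤ 1 / C₀ :=
    eventually_log_rpow_mul_exp_neg_le 4 (by positivity) (by positivity)
  have hev : ∀ᶠ X : ℝ in Filter.atTop, ∀ δ : ℝ, X ^ (-(13 / 15 : ℝ) + ε) ≤ δ →
      δ ≤ X ^ (-(1 / 100 : ℝ)) →
      ∫ x in X..(3 * X), (ψ (x + δ * x) - ψ x - δ * x) ^ 2 ≤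
        3 * δ ^ 2 * X ^ 3 * Real.exp (-A₁ * Real.log X ^ (1 / 4 : ℝ)) := by
    filter_upwards [hE1, hE2, hE4, hE5, hE6, hE7, hE8, Filter.eventually_ge_atTop (21 : ℝ)]
      with X h1 h2 h4 h5 h6 h7 h8 hX21 δ hδlo hδhi
    have hX0 : 0 < X := by linarith
    have hL1 : 1 ≤ Real.log X := by
      rw [Real.le_log_iff_exp_le hX0]; have := Real.exp_one_lt_d9; linarith
    have hL0 : 0 < Real.log X := by linarith
    -- reshape the growth conditions
    have h2' : Real.exp ((A₁ + 1) * Real.log X ^ (1 / 4 : ℝ)) ≤ X ^ (ε / 2) := by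
      simpa [Real.rpow_zero] using h2
    have h5' : CN * Real.log X * Real.exp ((A₁ + 1) * Real.log X ^ (1 / 4 : ℝ)) ≤ Cd * X ^ (2 / 15 : ℝ) := by
      rw [Real.rpow_one] at h5
      have := mul_le_mul_of_nonneg_left h5 hCN.le
      rw [show CN * (Cd / CN * X ^ (2 / 15 : ℝ)) = Cd * X ^ (2 / 15 : ℝ) by field_simp] at this
      linarith
    have h6' : 4 * Real.exp 2 * C₀ * Cd * (Real.log X ^ max B 0 * Real.log X ^ 3) *
        Real.exp (-1 * Real.log X ^ (1 / 4 : ℝ)) ≤ 1 := by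
      have e : Real.log X ^ max B 0 * Real.log X ^ 3 = Real.log X ^ (max B 0 + 3) := by
        rw [Real.rpow_add hL0, ← Real.rpow_natCast]; norm_num
      rw [e]
      have := mul_le_mul_of_nonneg_left h6 (by positivity : (0 : ℝ) ≤ 4 * Real.exp 2 * C₀ * Cd)
      rw [show 4 * Real.exp 2 * C₀ * Cd * (1 / (4 * Real.exp 2 * C₀ * Cd)) = 1 by field_simp] at this
      linarith
    have h7' : C₀ * Real.log X ^ 2 * Real.exp (A₁ * Real.log X ^ (1 / 4 : ℝ)) ≤ X ^ (4 / 15 : ℝ) := by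
      rw [Real.rpow_two] at h7
      have := mul_le_mul_of_nonneg_left h7 hC₀.le
      rw [show C₀ * (1 / C₀ * X ^ (4 / 15 : ℝ)) = X ^ (4 / 15 : ℝ) by field_simp] at this
      linarith
    have h8' : C₀ * Real.log X ^ 4 * Real.exp (-(A₁ + 2) * Real.log X ^ (1 / 4 : ℝ)) ≤ 1 := by
      rw [show (4 : ℝ) = ((4 : ℕ) : ℝ) by norm_num, Real.rpow_natCast] at h8
      have := mul_le_mul_of_nonneg_left h8 hC₀.le
      rw [show C₀ * (1 / C₀) = 1 by field_simp] at this
      linarith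
    exact final_step hX21 hε hA₁1 hC₀ hCN hCd hK hcore htotal hdens hδlo hδhi h1 h2' h4 h5' h6' h7' h8'
  obtain ⟨X₀, hX₀⟩ := Filter.eventually_atTop.1 hev
  refine ⟨3, max X₀ 1, fun X hX δ hδlo hδhi ↦
    (hX₀ X ((le_max_left _ _).trans hX) δ hδlo hδhi).trans ?_⟩
  have hX1 : 1 ≤ X := (le_max_right _ _).trans hX
  have ht0 : 0 ≤ Real.log X ^ (1 / 4 : ℝ) := Real.rpow_nonneg (Real.log_nonneg hX1) _
  have hX0 : 0 ≤ X := by linarith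
  have hexp : Real.exp (-A₁ * Real.log X ^ (1 / 4 : ℝ)) ≤ Real.exp (-A * Real.log X ^ (1 / 4 : ℝ)) :=
    Real.exp_le_exp.2 (by nlinarith)
  exact mul_le_mul_of_nonneg_left hexp (by positivity)

/-- **The same with the zero-free region discharged**: the tree proves the (inexplicit)
Vinogradov–Korobov region for `ζ` from Vinogradov's exponential-sum estimate
(`VKZeta.expSumBound_ivic`, Ivić Thm. 6.2, and `zeta_zeroFree_of_expSumBound`), so only the
combined density bound `N(σ,T) ≤ C T^{(30/13+η)(1−σ)}(log T)^B` remains as a hypothesis: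
for every `ε > 0` and `A`,
`∫_X^{3X} (ψ(x+δx) − ψ(x) − δx)² dx ≤ C δ² X³ exp(−A (log X)^{1/4})` for `X ≥ X₀`,
`X^{−13/15+ε} ≤ δ ≤ X^{−1/100}`. [cite: GuthMaynard2026, §13.2, proof of Corollary 1.4, arXiv p0029:L30–L62] -/
theorem psiMeanSquareShort_of_combinedDensity
    (hcomb : ∀ η : ℝ, 0 < η → ∃ C B T₀ : ℝ, 0 < C ∧ ∀ T : ℝ, T₀ ≤ T → ∀ σ : ℝ, 1 / 2 ≤ σ → σ ≤ 1 →
      (zetaZeroCountRe σ T : ℝ) ≤ C * T ^ ((30 / 13 + η) * (1 - σ)) * Real.log T ^ B)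
    (ε : ℝ) (hε : 0 < ε) (A : ℝ) :
    ∃ C X₀ : ℝ, ∀ X : ℝ, X₀ ≤ X → ∀ δ : ℝ,
      X ^ (-(13 / 15 : ℝ) + ε) ≤ δ → δ ≤ X ^ (-(1 / 100 : ℝ)) →
      ∫ x in X..(3 * X), (ψ (x + δ * x) - ψ x - δ * x) ^ 2 ≤
        C * δ ^ 2 * X ^ 3 * Real.exp (-A * Real.log X ^ (1 / 4 : ℝ)) := by
  obtain ⟨C, D, hC, hD, h⟩ := VKZeta.expSumBound_ivic
  exact psiMeanSquareShort_of_combined hcomb (zeta_zeroFree_of_expSumBound h hC hD) ε hε A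

end Literature.NumberTheory.LFunctions.GuthMaynardPsiMeanSquare

/-! ### §13 The cell interface: `NearOneZeroDensity → GuthMaynard2026_psiMeanSquareShort` -/

namespace Literature.NumberTheory.LFunctions

/-- **Guth–Maynard §13.2, the mean-square target (eq. AlmostAllTarget with the explicit-formula
step) from the near-one density interface**: `NearOneZeroDensity` (a zero-density estimate
`N(σ,T) ≪ T^{B(1−σ)^{3/2}}(log T)^C` near `σ = 1`, GM's "[J] or [M3]") implies
`GuthMaynard2026_psiMeanSquareShort`: for every `ε > 0` and `A`,
`∫_X^{3X} (ψ(x+δx) − ψ(x) − δx)² dx ≤ C δ² X³ exp(−A (log X)^{1/4})` for `X ≥ X₀`,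
`X^{−13/15+ε} ≤ δ ≤ X^{−1/100}`. The `30/13` density theorem
(`zeroDensity_thirty_thirteenths_holds`) and the Vinogradov–Korobov region are supplied by the tree
(`zetaZeroCountRe_le_combined`, `zeta_zeroFree_of_expSumBound`). [cite: GuthMaynard2026, §13.2, proof of Corollary 1.4 (eq. AlmostAllTarget), arXiv p0029:L30–L62] -/
theorem GuthMaynard2026_psiMeanSquareShort_of_nearOne (h : NearOneZeroDensity) :
    GuthMaynard2026_psiMeanSquareShort :=
  fun ε hε A ↦ GuthMaynardPsiMeanSquare.psiMeanSquareShort_of_combinedDensity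
    (zetaZeroCountRe_le_combined h) ε hε A

/-- **The same from Ivić's Theorem 11.3** (the named fact `Ivic1985_theorem11_3`, Ivić 1985
(11.32)), through `nearOneZeroDensity_of_Ivic1985_theorem11_3`. [cite: GuthMaynard2026, §13.2, proof of Corollary 1.4 (eq. AlmostAllTarget), arXiv p0029:L30–L62] -/
theorem GuthMaynard2026_psiMeanSquareShort_of_Ivic1985_theorem11_3 (h : Ivic1985_theorem11_3) :
    GuthMaynard2026_psiMeanSquareShort :=
  GuthMaynard2026_psiMeanSquareShort_of_nearOne (nearOneZeroDensity_of_Ivic1985_theorem11_3 h)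

end Literature.NumberTheory.LFunctions

end
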